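import Summits.KontsevichZagierPeriods.KontsevichZagierPeriods.Theses.LiouvilleUnfolding
import Literature.NumberTheory.Transcendental.KZLogCalculus
import Literature.NumberTheory.Transcendental.KZLogCalculusProofs
import Literature.NumberTheory.Transcendental.KZSemialgebraicComplex
import Literature.NumberTheory.Transcendental.KZKernelConjectureForms
import Literature.NumberTheory.Transcendental.KZCalculusProofs
import Literature.NumberTheory.Transcendental.KZUnfolding
import Literature.Barriers.KontsevichZagierPeriods.AlgebraicPrimitivesObstruction
import Summits.KontsevichZagierPeriods.KontsevichZagierPeriods.Theorems.MzvKernelInKZ.Negative.Duality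
import Literature.NumberTheory.Transcendental.LindemannWeierstrassProofs
import Literature.NumberTheory.Transcendental.BakerLogarithmsConclusion
import Literature.NumberTheory.Transcendental.SemialgebraicMapsProofs

/-!
# Disproof of `LogPrimitiveNL` (stmt-KontsevichZagierPeriods-2836) — standing adversary, findings

Crux (route LiouvilleUnfolding, rank 3): the LOGARITHMIC Newton–Leibniz step is derivable in the
four-move calculus — for a band `r = [{x ∈ τ, a x ≤ t ≤ b x}, Σᵢ hᵢ(x) ∂ₜVᵢ/Vᵢ]` and a base
`r' = [τ, Σᵢ hᵢ(x)(log Vᵢ(x, b x) − log Vᵢ(x, a x))]`, both honest `KZ.IntegralRep`s, with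
`a ≤ b`, `hᵢ`, `Vᵢ` `ℚ`-semialgebraic, `Vᵢ > 0`, `Vᵢ` continuous on closed fibres with `t`-derivative
`Vᵢ'` on open fibres, `hᵢVᵢ'/Vᵢ` termwise integrable: `[r] − [r'] ∈ KZ.relations`.

VERDICT (cycle 1): NO KILL, and none is possible short of refuting Conjecture 1 as formalised
(and the crux is now REDUCED to its band form: `crux_iff_bandForm`, §10 — the base representation is
always a relation, by Baker):
the hypotheses force `r.value = r'.value` (`value_eq_of_logData`, Fubini + FTC with the
transcendental primitive `Σ hᵢ log Vᵢ`), so the crux is a CONSEQUENCE of the kernel conjecture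
(`of_kzKernelConjecture`) and of the summit (`of_summit`, `not_summit_of_not`). The only invariant of
`KZ.relations` in the tree is `KZ.eval` (soundness); a refutation needs a finer additive invariant
(`not_of_separating_invariant`), i.e. a counterexample to the period conjecture.

INDEX (everything sorry-free; axioms = {propext, Classical.choice, Quot.sound}, checked on
`not_withoutContinuousOn`, `not_singleMove`):
* §0 `crux_iff` — literal read-back (`Iff.rfl`); hypothesis names `ha hb hab hdom hh hV hpos hcont
  hderiv hint hr hr'` are used throughout.
* §1 `value_eq_of_logData`, `eval_sub_eq_zero_of_logData` — values agree under the ANALYTIC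
  hypotheses alone (`hab hdom hpos hcont hderiv hr hr'`; no semialgebraicity, no termwise
  integrability), via `KZlog.setIntegral_band_eq_of_hasDerivAt`.
* §2 shape of any refutation: `of_kzKernelConjecture`, `of_summit`, `not_summit_of_not`,
  `not_of_separating_invariant`.
* §3 witness toolkit: `ptRep q = [ℝ⁰, q]` (`value_ptRep`), `band1 a b = [a,b] ⊂ ℝ¹` in the literal
  band shape over the point (`rfl` against `hdom`), `bandRep`, `setIntegral_band1_eq` (FTC),
  `value_eq_of_sub_mem_relations` (soundness).
* §4 LOAD-BEARING hypotheses ("any proof must use H"), each `¬ (crux without H)` by an explicit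
  `n = 0` datum with `r.value ≠ r'.value`:
  - `not_withoutLe` (`hab`): `a = 1 > 0 = b`, empty band, `V = exp t` vacuously admissible,
    `r' = [pt, −1]`;
  - `not_withoutContinuousOn` (`hcont`, continuity on the CLOSED fibre): `V₀` jumps `1 → 2` at the
    endpoint `t = 1` (`h₀ = 1`), `V₁ = 1 + t` (`h₁ = −1`) cancels the transcendental boundary term:
    `r = [[0,1], −1/(1+t)]` (value `−log 2`), `r' = [pt, 0]`;
  - `not_withoutHasDerivAt` (`hderiv`): `V = 1`, `V' = 1`, `r = [[0,1], 1]`, `r' = [pt, 0]`;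
  - `not_withoutDomain` (`hdom`, bookkeeping): `k = 0`, `r = [[5,6], step]`, `r' = [pt, 0]`.
* §5 NOT load-bearing modulo Conjecture 1: `Bare` (drop `ha hb hh hV hint` all at once) still
  follows from the kernel conjecture / the summit (`bare_of_kzKernelConjecture`, `bare_of_summit`,
  `crux_of_bare`). These hypotheses serve the CONSTRUCTION of a derivation (intermediate
  representations must be `KZ.IntegralRep`s), not the truth of the conclusion; no counterexample to
  the crux can come from violating them. `negV_of_crux`: the SIGN in `hpos` is immaterial
  (`V ↦ −V`, `Real.log |·|`).
* §6 a natural STRENGTHENING that is FALSE: `SingleMove` (the step is ONE `KZ.newtonLeibnizRel`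
  move, i.e. a `ℚ`-semialgebraic primitive exists on the band) implies the crux
  (`crux_of_singleMove`) and is refuted (`not_singleMove`) by the barrier's own kernel element
  `2t/(2 − t²) − 1/(2 − t) = −(log(2 − t²))' + (log(2 − t))'` on `[0,1]`
  (`Literature.Barriers.KontsevichZagierPeriods.KZ.algebraicPrimitivesObstructionNarrow_holds`):
  a VALID crux instance (`n = 0`, `k = 2`, boundary term `0`, `r' = [pt, 0]`), derivable in the
  calculus by one change of variables `t ↦ t²` plus additivity, but not by Newton–Leibniz in place.
  Any proof must leave the band's dimension or use rule 2) — as the unfolding plan does.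
* §6b CALIBRATION (tightness of §6): on the datum `V = (1 + t, 2 − t)`, `h = (1, 1)`,
  `r = affRep = [[0,1], 1/(1+t) − 1/(2−t)]`, `r' = [pt, 0]` the integrand has NO semialgebraic
  primitive (`no_semialgebraic_primitive_affRep`, simple-pole descent), yet the crux's conclusion
  HOLDS: `affRep_sub_ptRep_mem_relations`, an explicit chain of four move instances (rule 1b, the
  reflection `t ↦ 1 − t` as ONE rule-2 move reusing `MzvKernelInKZ.Negative.dualMap`, free
  cancellation, `[pt, 0]`). `affRep_sub_ptRep_mem_of_crux` documents admissibility of the datum.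
* §7 WHY IT RESISTS / what a proof must do: the ENGINE is already in the tree
  (`KZ.unfoldedLogStokes_mem_relations`, `KZlog.Conservative_holds`, fibre/affine substitution,
  unfolded product rule — `KZLogCalculusProofs.lean`); two instantiation wrinkles (semialgebraic
  `V'`; NON-integrable boundary monomials — explicit TRAP instance and the renormalisation
  `V ↦ V/A`); the residual content is BOUNDARY RIGIDITY (every admissible `r'` has integrand `0`
  a.e.; Ax–Schanuel `ax_schanuel_holds` + Baker `baker_holds`, both PROVED in tree, generate the
  vanishing from multiplicative identities realised by the move templates); `n = 0` is
  Baker-complete; regimes tried.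
* §8 `BoundaryRigidity` — the residual target TYPED, and `boundaryRigidity_of_crux :
  LogPrimitiveNL → BoundaryRigidity` PROVED (crux applied with `Vᵢ = 1 + t(Wᵢ − 1)`, then
  `KZ.of_sub_of_sub_sum_mem_relations` + `KZ.of_sub_of_mem_relations_fibreSubst`): a counterexample
  to BR refutes the crux; the converse is the prover's job (engine + renormalisation, §7.2).
* §8b `DimZero`, `BoundaryRigidityDimZero` — the `n = 0` cases typed (first milestone; content =
  Baker), with `dimZero_of_crux`, `boundaryRigidityDimZero_of_crux`.
* §9 RIGIDITY IN THE SMALLEST CASE, PROVED: `dimZero_one_balanced` — in an admissible datum with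
  `n = 0`, `k = 1`, over any base point `h = 0 ∨ V(·,b) = V(·,a)` (values over the point are
  algebraic — `isAlgebraic_of_isSemialgebraicFunOn_fin_zero`; Hermite–Lindemann
  `transcendental_exp_holds` ⇒ `log_eq_zero_of_isAlgebraic`); and FOR ALL `k`:
  `baker_sum_eq_zero` (inhomogeneous Baker from `baker_holds`: an algebraic value of a `ℚ̄`-linear
  form in logarithms of algebraic numbers is `0`) ⇒ `dimZero_boundary_eq_zero` (every admissible
  `r'` over the point has integrand `0`) ⇒ `dimZero_base_mem_relations` (`[r'] ∈ KZ.relations`): at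
  `n = 0` the crux is exactly "`[r] ∈ relations` for every admissible band datum" — §7.3(i) at
  `n = 0` with the transcendence input taken from the tree (Baker PROVED there).
* §10 THE BASE SIDE IS ALWAYS A RELATION (ALL `n`), PROVED: core `logCombination_eq_zero_ratCast`
  (a semialgebraic `Σ hᵢ(log Bᵢ − log Aᵢ)` vanishes at every rational point: `isAlgebraic_apply_ratCast`
  + Baker) and `logCombination_mem_relations` (such a representation is a relation: smooth on an open
  full-measure `G` by `KZ.exists_isOpen_contDiffOn`, zero there by density of `ℚⁿ`, split
  `[G, 0] + [null]`); instances `base_mem_relations` (`[r'] ∈ KZ.relations` for every admissible crux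
  datum, via `isSemialgebraicFunOn_endpointN`) and `br_base_mem_relations` (`[g]` of BR data);
  REFORMULATIONS `crux_iff_bandForm : LogPrimitiveNL ↔ BandForm` (conclusion `[r] ∈ relations`; `r'`
  never matters) and `boundaryRigidity_iff_sumForm : BoundaryRigidity ↔ BoundarySumForm` (conclusion
  `Σ [Uᵢ] ∈ relations`). §7.3(i) is thereby settled in full; ALL remaining content of the crux is the
  derivation of the band representation `[r]` (≡ `Σ [Uᵢ]`) from the four moves. And the band form's
  admissibility hypothesis `hr'` is LOAD-BEARING: `not_bandFormWithoutBase` (witness `repA`,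
  `value_repA = log 2`).
* TARGETS (picked line `logderiv-peeling`, skeleton `Lines/logderiv-peeling.lean`, read 2026-08-16T02:3x):
  all seven stubs look TRUE on inspection (no stub-false finding; details in §11); PROVED here for the
  lead: `constRigidity_vanishing` = the FIRST CONJUNCT of `stub_constRigidity` verbatim (`G ≡ 0`);
  `logCombinationFun_eq_zero_on_open` gives the `g ≡ 0 on cells` conjunct of `stub_descent` wherever
  `g` is continuous on the open cell; `br_base_mem_relations` makes `[g] ∈ relations` FREE in
  `boundaryRigidity_of_stubs` (the glue's `hg0` no longer needs `stub_descent`'s vanishing clause);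
  §12 `baker_relation_span_rat` / `baker_relation_span_int` — Baker in RELATION-SPAN form (every
  `ℚ̄`-relation among logs of algebraic numbers is a `ℚ̄`-combination of integer relations), the
  transcendence input of `stub_constRigidity`'s second conjunct, PROVED from `baker_holds`.

SIBLING CRUX (same route): the standing disprover of `LogKernelConjecture` (stmt-2837) LANDED
`Theorems/LogKernelConjecture/Negative/{Sandwich,LoadBearing,ClauseCensus,Torsion}.lean` (namespace
`Summit.KontsevichZagierPeriods.LiouvilleUnfolding.LogKernelConjectureNegative`); overlaps, consistent
with this file: `logPrimitiveNL_of_kzKernelConjecture` / `logPrimitiveNL_of_summit` (= §2 here),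
`logPrimitiveNL_iff_logClosure_eq : LogPrimitiveNL ↔ logClosure = KZ.relations`,
`summit_iff_logPrimitiveNL_and : KontsevichZagierPeriods ↔ LogPrimitiveNL ∧ LogKernelConjecture`, the
`hcont` deletion (their work file §11, = `not_withoutContinuousOn` here), and INTEGER DIVISION
`mem_relations_of_nsmul_mem_relations : 0 < N → N • c ∈ KZ.relations → c ∈ KZ.relations`
(Torsion.lean) — used in §7.3(ii) below (powers `Wⱼ^N`).

USE: provers may cite / re-land any lemma here under `Theorems/LogPrimitiveNL/…` with
`--supports stmt-KontsevichZagierPeriods-2836`. LANDED (cycle 1):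
`Theorems/LogPrimitiveNL/Negative/{Defs,Rigidity,LoadBearing,Strengthenings,TwoMoves,DimZero,BakerRelationSpan}.lean`
(namespace `Summit.KontsevichZagierPeriods.LiouvilleUnfolding.LogPrimitiveNL.Negative`, same short names
as here; `DimZero.lean` = §8b + §9, `BakerRelationSpan.lean` = §12; `BandForm.lean` = §10 in review,
`BandFormWithoutBase.lean` to follow) — IMPORT THOSE rather than this work file; `import
Summits.KontsevichZagierPeriods.KontsevichZagierPeriods.Cruxes.LogPrimitiveNL.Disproof` elaborates on
the farm. Targets (lead's stuck stubs): none yet (no line picked at cycle 1).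
-/

noncomputable section

set_option linter.dupNamespace false

open Set MeasureTheory
open Literature.NumberTheory.Transcendental

namespace Summit.KontsevichZagierPeriods.KontsevichZagierPeriods.Cruxes.LogPrimitiveNL.Disproof

open Summit.KontsevichZagierPeriods.KontsevichZagierPeriods.Theses.LiouvilleUnfolding
  (LogPrimitiveNL LogKernelConjecture)

/-! ## §1 Values: the hypotheses force `eval ([r] − [r']) = 0` -/

/-- Fibrewise membership in the band of the crux. -/
theorem snoc_mem_band_iff {n : ℕ} {τ : Set (Fin n → ℝ)} {a b : (Fin n → ℝ) → ℝ}
    {D : Set (Fin (n + 1) → ℝ)}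
    (hdom : D = {z | (Fin.init z : Fin n → ℝ) ∈ τ ∧ a (Fin.init z) ≤ z (Fin.last n) ∧
      z (Fin.last n) ≤ b (Fin.init z)})
    {x : Fin n → ℝ} {t : ℝ} :
    (Fin.snoc x t : Fin (n + 1) → ℝ) ∈ D ↔ x ∈ τ ∧ t ∈ Icc (a x) (b x) := by
  rw [hdom]
  exact KZlog.snoc_mem_band

/-- **Value equality (Fubini + FTC with the transcendental primitive `Σ hᵢ log Vᵢ`).** Under the
ANALYTIC hypotheses of the crux alone — `a ≤ b`, the band equation, `Vᵢ > 0`, continuity of `Vᵢ` on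
closed fibres, the derivative `Vᵢ'` on open fibres, and the two integrand equations — the two
representations have the same value. No semialgebraicity of `a, b, hᵢ, Vᵢ` and no termwise
integrability is used (only `r.integrableOn`). -/
theorem value_eq_of_logData {n k : ℕ} (r : KZ.IntegralRep (n + 1)) (r' : KZ.IntegralRep n)
    (a b : (Fin n → ℝ) → ℝ) (h : Fin k → (Fin n → ℝ) → ℝ)
    (V V' : Fin k → (Fin (n + 1) → ℝ) → ℝ)
    (hab : ∀ x ∈ r'.domain, a x ≤ b x)
    (hdom : r.domain = {z | (Fin.init z : Fin n → ℝ) ∈ r'.domain ∧ a (Fin.init z) ≤ z (Fin.last n) ∧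
      z (Fin.last n) ≤ b (Fin.init z)})
    (hpos : ∀ i, ∀ z ∈ r.domain, 0 < V i z)
    (hcont : ∀ i, ∀ x ∈ r'.domain, ContinuousOn (fun t : ℝ => V i (Fin.snoc x t)) (Icc (a x) (b x)))
    (hderiv : ∀ i, ∀ x ∈ r'.domain, ∀ t ∈ Ioo (a x) (b x),
      HasDerivAt (fun s : ℝ => V i (Fin.snoc x s)) (V' i (Fin.snoc x t)) t)
    (hr : ∀ x ∈ r'.domain, ∀ t ∈ Ioo (a x) (b x),
      r.integrand (Fin.snoc x t) = ∑ i, h i x * V' i (Fin.snoc x t) / V i (Fin.snoc x t))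
    (hr' : ∀ x ∈ r'.domain, r'.integrand x =
      ∑ i, h i x * (Real.log (V i (Fin.snoc x (b x))) - Real.log (V i (Fin.snoc x (a x))))) :
    r.value = r'.value := by
  have hτ : MeasurableSet r'.domain := KZ.IntegralRep.measurableSet_domain_holds r'
  have hB : MeasurableSet (KZlog.band r'.domain a b) := by
    have := KZ.IntegralRep.measurableSet_domain_holds r
    rwa [hdom] at this
  have hG : IntegrableOn r.integrand (KZlog.band r'.domain a b) := by
    have := r.integrableOn
    rwa [hdom] at this
  have hV0 : ∀ i, ∀ x ∈ r'.domain, ∀ t ∈ Icc (a x) (b x), V i (Fin.snoc x t) ≠ 0 :=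
    fun i x hx t ht => (hpos i _ ((snoc_mem_band_iff hdom).2 ⟨hx, ht⟩)).ne'
  set F : (Fin (n + 1) → ℝ) → ℝ := fun z => ∑ i, h i (Fin.init z) * Real.log (V i z) with hF
  have key := KZlog.setIntegral_band_eq_of_hasDerivAt hτ hab hB hG (F := F) ?_ ?_
  · unfold KZ.IntegralRep.value
    rw [hdom]
    change ∫ z in KZlog.band r'.domain a b, r.integrand z = _
    rw [key]
    refine setIntegral_congr_fun hτ fun x hx => ?_
    rw [hr' x hx]
    simp only [hF, Fin.init_snoc, ← Finset.sum_sub_distrib, mul_sub]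
  · intro x hx
    simp only [hF, Fin.init_snoc]
    exact continuousOn_finsetSum _ fun i _ =>
      continuousOn_const.mul ((hcont i x hx).log (hV0 i x hx))
  · intro x hx t ht
    simp only [hF, Fin.init_snoc]
    have hd : HasDerivAt (fun s : ℝ => ∑ i, h i x * Real.log (V i (Fin.snoc x s)))
        (∑ i, h i x * (V' i (Fin.snoc x t) / V i (Fin.snoc x t))) t :=
      HasDerivAt.fun_sum fun i _ =>
        (((hderiv i x hx t ht).log (hV0 i x hx t (Ioo_subset_Icc_self ht))).const_mul (h i x))
    rw [hr x hx t ht]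
    convert hd using 2 with i
    ring

/-- `eval ([r] − [r']) = 0` for every instance of the crux's analytic data. -/
theorem eval_sub_eq_zero_of_logData {n k : ℕ} (r : KZ.IntegralRep (n + 1)) (r' : KZ.IntegralRep n)
    (a b : (Fin n → ℝ) → ℝ) (h : Fin k → (Fin n → ℝ) → ℝ)
    (V V' : Fin k → (Fin (n + 1) → ℝ) → ℝ)
    (hab : ∀ x ∈ r'.domain, a x ≤ b x)
    (hdom : r.domain = {z | (Fin.init z : Fin n → ℝ) ∈ r'.domain ∧ a (Fin.init z) ≤ z (Fin.last n) ∧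
      z (Fin.last n) ≤ b (Fin.init z)})
    (hpos : ∀ i, ∀ z ∈ r.domain, 0 < V i z)
    (hcont : ∀ i, ∀ x ∈ r'.domain, ContinuousOn (fun t : ℝ => V i (Fin.snoc x t)) (Icc (a x) (b x)))
    (hderiv : ∀ i, ∀ x ∈ r'.domain, ∀ t ∈ Ioo (a x) (b x),
      HasDerivAt (fun s : ℝ => V i (Fin.snoc x s)) (V' i (Fin.snoc x t)) t)
    (hr : ∀ x ∈ r'.domain, ∀ t ∈ Ioo (a x) (b x),
      r.integrand (Fin.snoc x t) = ∑ i, h i x * V' i (Fin.snoc x t) / V i (Fin.snoc x t))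
    (hr' : ∀ x ∈ r'.domain, r'.integrand x =
      ∑ i, h i x * (Real.log (V i (Fin.snoc x (b x))) - Real.log (V i (Fin.snoc x (a x))))) :
    KZ.eval (KZ.of r - KZ.of r') = 0 := by
  rw [KZ.eval_of_sub_of, value_eq_of_logData r r' a b h V V' hab hdom hpos hcont hderiv hr hr',
    sub_self]

/-! ## §2 Shape of any refutation: the crux is a consequence of Conjecture 1 -/

/-- **The crux follows from the kernel conjecture** `ker eval = relations`: its conclusion is
membership of a KERNEL element (`eval_sub_eq_zero_of_logData`) in `relations`. -/
theorem of_kzKernelConjecture (hK : KZKernelConjecture) : LogPrimitiveNL := by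
  intro n k r r' a b h V V' _ _ hab hdom _ _ hpos hcont hderiv _ hr hr'
  exact hK _ (eval_sub_eq_zero_of_logData r r' a b h V V' hab hdom hpos hcont hderiv hr hr')

/-- **The crux follows from the summit** (Conjecture 1 as formalised, two-representation form over
KZ-literal data), via `kzKernelConjecture_iff_isRational`. -/
theorem of_summit (hS : _root_.KontsevichZagierPeriods) : LogPrimitiveNL :=
  of_kzKernelConjecture (kzKernelConjecture_iff_isRational.mpr hS)

/-- Hence ANY disproof of `LogPrimitiveNL` is a disproof of the summit: there is no refutation
cheaper than a counterexample to Conjecture 1 (an additive invariant of `KZ.FormalRep` killing the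
four move sets and separating `[r]` from `[r']` for some logarithmic Newton–Leibniz datum). -/
theorem not_summit_of_not (h : ¬ LogPrimitiveNL) : ¬ _root_.KontsevichZagierPeriods :=
  mt of_summit h

/-- TEMPLATE of a refutation: an additive invariant `J` vanishing on the four move sets together
with ONE logarithmic Newton–Leibniz datum on which `J [r] ≠ J [r']`. Soundness makes `KZ.eval`
such an invariant except for the last clause (`eval_sub_eq_zero_of_logData`): `J` must see more
than the value. No such `J` is known (it would be a "non-motivic" invariant of real periods). -/
theorem not_of_separating_invariant {A : Type*} [AddCommGroup A] (J : KZ.FormalRep →+ A)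
    (hJ : ∀ x ∈ KZ.domainAddRel ∪ KZ.integrandAddRel ∪ KZ.changeOfVariablesRel ∪ KZ.newtonLeibnizRel,
      J x = 0)
    {n k : ℕ} (r : KZ.IntegralRep (n + 1)) (r' : KZ.IntegralRep n)
    (a b : (Fin n → ℝ) → ℝ) (h : Fin k → (Fin n → ℝ) → ℝ)
    (V V' : Fin k → (Fin (n + 1) → ℝ) → ℝ)
    (ha : IsSemialgebraicFunOn ℚ r'.domain a) (hb : IsSemialgebraicFunOn ℚ r'.domain b)
    (hab : ∀ x ∈ r'.domain, a x ≤ b x)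
    (hdom : r.domain = {z | (Fin.init z : Fin n → ℝ) ∈ r'.domain ∧ a (Fin.init z) ≤ z (Fin.last n) ∧
      z (Fin.last n) ≤ b (Fin.init z)})
    (hh : ∀ i, IsSemialgebraicFunOn ℚ r'.domain (h i))
    (hV : ∀ i, IsSemialgebraicFunOn ℚ r.domain (V i))
    (hpos : ∀ i, ∀ z ∈ r.domain, 0 < V i z)
    (hcont : ∀ i, ∀ x ∈ r'.domain, ContinuousOn (fun t : ℝ => V i (Fin.snoc x t)) (Icc (a x) (b x)))
    (hderiv : ∀ i, ∀ x ∈ r'.domain, ∀ t ∈ Ioo (a x) (b x),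
      HasDerivAt (fun s : ℝ => V i (Fin.snoc x s)) (V' i (Fin.snoc x t)) t)
    (hint : ∀ i, IntegrableOn (fun z => h i (Fin.init z) * V' i z / V i z) r.domain)
    (hr : ∀ x ∈ r'.domain, ∀ t ∈ Ioo (a x) (b x),
      r.integrand (Fin.snoc x t) = ∑ i, h i x * V' i (Fin.snoc x t) / V i (Fin.snoc x t))
    (hr' : ∀ x ∈ r'.domain, r'.integrand x =
      ∑ i, h i x * (Real.log (V i (Fin.snoc x (b x))) - Real.log (V i (Fin.snoc x (a x)))))
    (hJrr' : J (KZ.of r) ≠ J (KZ.of r')) :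
    ¬ LogPrimitiveNL := by
  intro hc
  have hker : KZ.relations ≤ J.ker := (AddSubgroup.closure_le _).mpr fun x hx => hJ x hx
  have hmem := hker (hc n k r r' a b h V V' ha hb hab hdom hh hV hpos hcont hderiv hint hr hr')
  rw [AddMonoidHom.mem_ker, map_sub, sub_eq_zero] at hmem
  exact hJrr' hmem


/-! ## §3 Witness toolkit: the point `ℝ⁰`, bands `[a, b] ⊂ ℝ¹` over it -/

/-- Integration over `ℝ⁰` is evaluation at the point. -/
theorem integral_fin_zero (f : (Fin 0 → ℝ) → ℝ) : ∫ x, f x = f (fun i => i.elim0) := by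
  rw [volume_pi, Measure.pi_of_empty (fun _ => (volume : Measure ℝ)) (fun i => i.elim0),
    integral_dirac]

/-- Integration over `univ ⊆ ℝ⁰` is evaluation at the point. -/
theorem setIntegral_univ_fin_zero (f : (Fin 0 → ℝ) → ℝ) :
    ∫ x in (univ : Set (Fin 0 → ℝ)), f x = f (fun i => i.elim0) := by
  rw [Measure.restrict_univ, integral_fin_zero]

/-- Rational constants are `ℚ`-semialgebraic functions on any `ℚ`-semialgebraic set. -/
theorem isSemialgebraicFunOn_const {m : ℕ} {s : Set (Fin m → ℝ)}
    (hs : Literature.ModelTheory.ExponentialFields.IsSemialgebraic ℚ s) (q : ℚ) :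
    IsSemialgebraicFunOn ℚ s (fun _ => (q : ℝ)) :=
  (isSemialgebraicFunOn_aeval hs (MvPolynomial.C q)).congr fun x _ => by simp

/-- The constant representation `[ℝ⁰, q]` of a rational number `q` (dimension `0`). -/
def ptRep (q : ℚ) : KZ.IntegralRep 0 where
  domain := univ
  integrand := fun _ => (q : ℝ)
  isSemialgebraic_domain := Literature.ModelTheory.ExponentialFields.isSemialgebraic_univ
  isSemialgebraicFunOn_integrand :=
    isSemialgebraicFunOn_const Literature.ModelTheory.ExponentialFields.isSemialgebraic_univ q
  integrableOn := by
    have : IsFiniteMeasure (volume : Measure (Fin 0 → ℝ)) := by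
      rw [volume_pi, Measure.pi_of_empty]; infer_instance
    exact integrableOn_const

@[simp] theorem domain_ptRep (q : ℚ) : (ptRep q).domain = univ := rfl

@[simp] theorem integrand_ptRep (q : ℚ) (x : Fin 0 → ℝ) : (ptRep q).integrand x = q := rfl

@[simp] theorem value_ptRep (q : ℚ) : (ptRep q).value = q := by
  change ∫ _ in (univ : Set (Fin 0 → ℝ)), (q : ℝ) = q
  rw [setIntegral_univ_fin_zero]

/-- The band `{z | init z ∈ ℝ⁰, a ≤ z₀ ≤ b} ⊂ ℝ¹` — LITERALLY the band shape of the crux over the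
one-point base with constant edges (so that the band equation of the crux holds by `rfl`). -/
def band1 (a b : ℝ) : Set (Fin 1 → ℝ) :=
  {z | (Fin.init z : Fin 0 → ℝ) ∈ (univ : Set (Fin 0 → ℝ)) ∧ a ≤ z (Fin.last 0) ∧ z (Fin.last 0) ≤ b}

@[simp] theorem mem_band1 {a b : ℝ} {z : Fin 1 → ℝ} : z ∈ band1 a b ↔ a ≤ z 0 ∧ z 0 ≤ b :=
  ⟨fun h => ⟨h.2.1, h.2.2⟩, fun h => ⟨mem_univ _, h.1, h.2⟩⟩

theorem band1_eq_pi (a b : ℝ) : band1 a b = Set.pi univ fun _ => Icc a b := by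
  ext z
  rw [mem_band1, Set.mem_univ_pi]
  simp only [Fin.forall_fin_one, mem_Icc]

theorem isCompact_band1 (a b : ℝ) : IsCompact (band1 a b) := by
  rw [band1_eq_pi]
  exact isCompact_univ_pi fun _ => isCompact_Icc

theorem isSemialgebraic_band1 (p q : ℚ) :
    Literature.ModelTheory.ExponentialFields.IsSemialgebraic ℚ (band1 (p : ℝ) (q : ℝ)) :=
  KZlog.isSemialgebraic_band
    (isSemialgebraicFunOn_const Literature.ModelTheory.ExponentialFields.isSemialgebraic_univ p)
    (isSemialgebraicFunOn_const Literature.ModelTheory.ExponentialFields.isSemialgebraic_univ q)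

theorem snoc_mem_band1 {a b : ℝ} {x : Fin 0 → ℝ} {t : ℝ} :
    (Fin.snoc x t : Fin 1 → ℝ) ∈ band1 a b ↔ t ∈ Icc a b := by
  simp only [band1, mem_setOf_eq, mem_univ, true_and, Fin.snoc_last, mem_Icc]

/-- The value of a function on `ℝ¹` along the fibre over the point: `(snoc x t)₀ = t`. -/
@[simp] theorem snoc_fin_one_apply_zero (x : Fin 0 → ℝ) (t : ℝ) :
    (Fin.snoc x t : Fin 1 → ℝ) 0 = t := by
  rw [show (0 : Fin 1) = Fin.last 0 from rfl, Fin.snoc_last]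

/-- A representation `[[a, b], G]` on a band over the point (dimension `1`), for a continuous
`ℚ`-semialgebraic integrand `G`. -/
def bandRep (a b : ℝ) (hs : Literature.ModelTheory.ExponentialFields.IsSemialgebraic ℚ (band1 a b))
    (G : (Fin 1 → ℝ) → ℝ) (hG : IsSemialgebraicFunOn ℚ (band1 a b) G)
    (hGc : ContinuousOn G (band1 a b)) : KZ.IntegralRep 1 where
  domain := band1 a b
  integrand := G
  isSemialgebraic_domain := hs
  isSemialgebraicFunOn_integrand := hG
  integrableOn := hGc.integrableOn_compact (isCompact_band1 a b)

@[simp] theorem domain_bandRep (a b : ℝ) (hs) (G : (Fin 1 → ℝ) → ℝ) (hG) (hGc) :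
    (bandRep a b hs G hG hGc).domain = band1 a b := rfl

@[simp] theorem integrand_bandRep (a b : ℝ) (hs) (G : (Fin 1 → ℝ) → ℝ) (hG) (hGc) :
    (bandRep a b hs G hG hGc).integrand = G := rfl

/-- **FTC on a band over the point**: `∫_{[a,b]} G = f b − f a` for a primitive `f` of `G`
(continuous on `[a, b]`, derivative `G` inside), via `KZlog.setIntegral_band_eq_of_hasDerivAt` with
the one-point base. -/
theorem setIntegral_band1_eq {a b : ℝ} (hab : a ≤ b) {G : (Fin 1 → ℝ) → ℝ}
    (hG : IntegrableOn G (band1 a b)) {f : ℝ → ℝ} (hfc : ContinuousOn f (Icc a b))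
    (hfd : ∀ (x : Fin 0 → ℝ), ∀ t ∈ Ioo a b, HasDerivAt f (G (Fin.snoc x t)) t) :
    ∫ z in band1 a b, G z = f b - f a := by
  have hB : MeasurableSet (band1 a b) := (isCompact_band1 a b).isClosed.measurableSet
  have key := KZlog.setIntegral_band_eq_of_hasDerivAt (τ := (univ : Set (Fin 0 → ℝ)))
    (a := fun _ => a) (b := fun _ => b) MeasurableSet.univ (fun _ _ => hab) hB hG
    (F := fun z => f (z (Fin.last 0))) (fun x _ => by simpa only [Fin.snoc_last] using hfc)
    (fun x _ t ht => by simpa only [Fin.snoc_last] using hfd x t ht)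
  have e : (∫ z in band1 a b, G z) =
      ∫ z in KZlog.band (univ : Set (Fin 0 → ℝ)) (fun _ => a) (fun _ => b), G z := rfl
  rw [e, key, setIntegral_univ_fin_zero]
  simp only [Fin.snoc_last]

/-- Soundness, as used against every variant below: a relation has equal values at both ends. -/
theorem value_eq_of_sub_mem_relations {n m : ℕ} {r : KZ.IntegralRep n} {r' : KZ.IntegralRep m}
    (h : KZ.of r - KZ.of r' ∈ KZ.relations) : r.value = r'.value :=
  KZ.Equivalent.value_eq_holds h


/-! ## §0 Read-back of the crux (literal, `Iff.rfl`) -/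

/-- The crux, literally (checked by `Iff.rfl`); hypotheses in order: `ha hb hab hdom hh hV hpos hcont
hderiv hint hr hr'`. -/
theorem crux_iff : LogPrimitiveNL ↔
    ∀ (n k : ℕ) (r : KZ.IntegralRep (n + 1)) (r' : KZ.IntegralRep n) (a b : (Fin n → ℝ) → ℝ)
    (h : Fin k → (Fin n → ℝ) → ℝ) (V V' : Fin k → (Fin (n + 1) → ℝ) → ℝ),
    IsSemialgebraicFunOn ℚ r'.domain a →
    IsSemialgebraicFunOn ℚ r'.domain b →
    (∀ x ∈ r'.domain, a x ≤ b x) →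
    r.domain = {z | (Fin.init z : Fin n → ℝ) ∈ r'.domain ∧ a (Fin.init z) ≤ z (Fin.last n) ∧
      z (Fin.last n) ≤ b (Fin.init z)} →
    (∀ i, IsSemialgebraicFunOn ℚ r'.domain (h i)) →
    (∀ i, IsSemialgebraicFunOn ℚ r.domain (V i)) →
    (∀ i, ∀ z ∈ r.domain, 0 < V i z) →
    (∀ i, ∀ x ∈ r'.domain, ContinuousOn (fun t : ℝ => V i (Fin.snoc x t)) (Icc (a x) (b x))) →
    (∀ i, ∀ x ∈ r'.domain, ∀ t ∈ Ioo (a x) (b x),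
      HasDerivAt (fun s : ℝ => V i (Fin.snoc x s)) (V' i (Fin.snoc x t)) t) →
    (∀ i, IntegrableOn (fun z => h i (Fin.init z) * V' i z / V i z) r.domain) →
    (∀ x ∈ r'.domain, ∀ t ∈ Ioo (a x) (b x),
      r.integrand (Fin.snoc x t) = ∑ i, h i x * V' i (Fin.snoc x t) / V i (Fin.snoc x t)) →
    (∀ x ∈ r'.domain, r'.integrand x =
      ∑ i, h i x * (Real.log (V i (Fin.snoc x (b x))) - Real.log (V i (Fin.snoc x (a x))))) →
    KZ.of r - KZ.of r' ∈ KZ.relations :=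
  Iff.rfl

/-! ## §4 Load-bearing hypotheses: drop one of `hab`, `hcont`, `hderiv`, `hdom` and the statement is FALSE

Each refutation is an explicit datum in dimension `n = 0` (base = the point `ℝ⁰`, band `⊂ ℝ¹`)
satisfying every remaining hypothesis, with `r.value ≠ r'.value`; soundness of the calculus
(`KZ.relations_le_ker_eval_holds`) then forbids `[r] − [r'] ∈ relations`. -/

/-- The crux with `a ≤ b` on the base DROPPED. -/
def WithoutLe : Prop :=
  ∀ (n k : ℕ) (r : KZ.IntegralRep (n + 1)) (r' : KZ.IntegralRep n) (a b : (Fin n → ℝ) → ℝ)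
    (h : Fin k → (Fin n → ℝ) → ℝ) (V V' : Fin k → (Fin (n + 1) → ℝ) → ℝ),
    IsSemialgebraicFunOn ℚ r'.domain a →
    IsSemialgebraicFunOn ℚ r'.domain b →
    r.domain = {z | (Fin.init z : Fin n → ℝ) ∈ r'.domain ∧ a (Fin.init z) ≤ z (Fin.last n) ∧
      z (Fin.last n) ≤ b (Fin.init z)} →
    (∀ i, IsSemialgebraicFunOn ℚ r'.domain (h i)) →
    (∀ i, IsSemialgebraicFunOn ℚ r.domain (V i)) →
    (∀ i, ∀ z ∈ r.domain, 0 < V i z) →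
    (∀ i, ∀ x ∈ r'.domain, ContinuousOn (fun t : ℝ => V i (Fin.snoc x t)) (Icc (a x) (b x))) →
    (∀ i, ∀ x ∈ r'.domain, ∀ t ∈ Ioo (a x) (b x),
      HasDerivAt (fun s : ℝ => V i (Fin.snoc x s)) (V' i (Fin.snoc x t)) t) →
    (∀ i, IntegrableOn (fun z => h i (Fin.init z) * V' i z / V i z) r.domain) →
    (∀ x ∈ r'.domain, ∀ t ∈ Ioo (a x) (b x),
      r.integrand (Fin.snoc x t) = ∑ i, h i x * V' i (Fin.snoc x t) / V i (Fin.snoc x t)) →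
    (∀ x ∈ r'.domain, r'.integrand x =
      ∑ i, h i x * (Real.log (V i (Fin.snoc x (b x))) - Real.log (V i (Fin.snoc x (a x))))) →
    KZ.of r - KZ.of r' ∈ KZ.relations

/-- The crux with continuity of `Vᵢ` on the CLOSED fibres DROPPED. -/
def WithoutContinuousOn : Prop :=
  ∀ (n k : ℕ) (r : KZ.IntegralRep (n + 1)) (r' : KZ.IntegralRep n) (a b : (Fin n → ℝ) → ℝ)
    (h : Fin k → (Fin n → ℝ) → ℝ) (V V' : Fin k → (Fin (n + 1) → ℝ) → ℝ),
    IsSemialgebraicFunOn ℚ r'.domain a →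
    IsSemialgebraicFunOn ℚ r'.domain b →
    (∀ x ∈ r'.domain, a x ≤ b x) →
    r.domain = {z | (Fin.init z : Fin n → ℝ) ∈ r'.domain ∧ a (Fin.init z) ≤ z (Fin.last n) ∧
      z (Fin.last n) ≤ b (Fin.init z)} →
    (∀ i, IsSemialgebraicFunOn ℚ r'.domain (h i)) →
    (∀ i, IsSemialgebraicFunOn ℚ r.domain (V i)) →
    (∀ i, ∀ z ∈ r.domain, 0 < V i z) →
    (∀ i, ∀ x ∈ r'.domain, ∀ t ∈ Ioo (a x) (b x),
      HasDerivAt (fun s : ℝ => V i (Fin.snoc x s)) (V' i (Fin.snoc x t)) t) →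
    (∀ i, IntegrableOn (fun z => h i (Fin.init z) * V' i z / V i z) r.domain) →
    (∀ x ∈ r'.domain, ∀ t ∈ Ioo (a x) (b x),
      r.integrand (Fin.snoc x t) = ∑ i, h i x * V' i (Fin.snoc x t) / V i (Fin.snoc x t)) →
    (∀ x ∈ r'.domain, r'.integrand x =
      ∑ i, h i x * (Real.log (V i (Fin.snoc x (b x))) - Real.log (V i (Fin.snoc x (a x))))) →
    KZ.of r - KZ.of r' ∈ KZ.relations

/-- The crux with the fibrewise derivative hypothesis (`Vᵢ'` is the `t`-derivative of `Vᵢ`) DROPPED. -/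
def WithoutHasDerivAt : Prop :=
  ∀ (n k : ℕ) (r : KZ.IntegralRep (n + 1)) (r' : KZ.IntegralRep n) (a b : (Fin n → ℝ) → ℝ)
    (h : Fin k → (Fin n → ℝ) → ℝ) (V V' : Fin k → (Fin (n + 1) → ℝ) → ℝ),
    IsSemialgebraicFunOn ℚ r'.domain a →
    IsSemialgebraicFunOn ℚ r'.domain b →
    (∀ x ∈ r'.domain, a x ≤ b x) →
    r.domain = {z | (Fin.init z : Fin n → ℝ) ∈ r'.domain ∧ a (Fin.init z) ≤ z (Fin.last n) ∧
      z (Fin.last n) ≤ b (Fin.init z)} →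
    (∀ i, IsSemialgebraicFunOn ℚ r'.domain (h i)) →
    (∀ i, IsSemialgebraicFunOn ℚ r.domain (V i)) →
    (∀ i, ∀ z ∈ r.domain, 0 < V i z) →
    (∀ i, ∀ x ∈ r'.domain, ContinuousOn (fun t : ℝ => V i (Fin.snoc x t)) (Icc (a x) (b x))) →
    (∀ i, IntegrableOn (fun z => h i (Fin.init z) * V' i z / V i z) r.domain) →
    (∀ x ∈ r'.domain, ∀ t ∈ Ioo (a x) (b x),
      r.integrand (Fin.snoc x t) = ∑ i, h i x * V' i (Fin.snoc x t) / V i (Fin.snoc x t)) →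
    (∀ x ∈ r'.domain, r'.integrand x =
      ∑ i, h i x * (Real.log (V i (Fin.snoc x (b x))) - Real.log (V i (Fin.snoc x (a x))))) →
    KZ.of r - KZ.of r' ∈ KZ.relations

/-- The crux with the band equation `r.domain = {(x,t) | x ∈ τ, a x ≤ t ≤ b x}` DROPPED. -/
def WithoutDomain : Prop :=
  ∀ (n k : ℕ) (r : KZ.IntegralRep (n + 1)) (r' : KZ.IntegralRep n) (a b : (Fin n → ℝ) → ℝ)
    (h : Fin k → (Fin n → ℝ) → ℝ) (V V' : Fin k → (Fin (n + 1) → ℝ) → ℝ),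
    IsSemialgebraicFunOn ℚ r'.domain a →
    IsSemialgebraicFunOn ℚ r'.domain b →
    (∀ x ∈ r'.domain, a x ≤ b x) →
    (∀ i, IsSemialgebraicFunOn ℚ r'.domain (h i)) →
    (∀ i, IsSemialgebraicFunOn ℚ r.domain (V i)) →
    (∀ i, ∀ z ∈ r.domain, 0 < V i z) →
    (∀ i, ∀ x ∈ r'.domain, ContinuousOn (fun t : ℝ => V i (Fin.snoc x t)) (Icc (a x) (b x))) →
    (∀ i, ∀ x ∈ r'.domain, ∀ t ∈ Ioo (a x) (b x),
      HasDerivAt (fun s : ℝ => V i (Fin.snoc x s)) (V' i (Fin.snoc x t)) t) →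
    (∀ i, IntegrableOn (fun z => h i (Fin.init z) * V' i z / V i z) r.domain) →
    (∀ x ∈ r'.domain, ∀ t ∈ Ioo (a x) (b x),
      r.integrand (Fin.snoc x t) = ∑ i, h i x * V' i (Fin.snoc x t) / V i (Fin.snoc x t)) →
    (∀ x ∈ r'.domain, r'.integrand x =
      ∑ i, h i x * (Real.log (V i (Fin.snoc x (b x))) - Real.log (V i (Fin.snoc x (a x))))) →
    KZ.of r - KZ.of r' ∈ KZ.relations

section Witnesses

open Literature.ModelTheory.ExponentialFields (isSemialgebraic_univ)

/-! ### (a) `a ≤ b` is load-bearing -/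

theorem not_mem_band1_one_zero (z : Fin 1 → ℝ) : z ∉ band1 1 0 := fun hz => by
  have h := mem_band1.1 hz
  linarith [h.1, h.2]

theorem band1_one_zero_eq_empty : band1 (1 : ℝ) 0 = ∅ :=
  Set.subset_empty_iff.mp fun z hz => (not_mem_band1_one_zero z hz).elim

theorem isSemialgebraic_band1_one_zero :
    Literature.ModelTheory.ExponentialFields.IsSemialgebraic ℚ (band1 (1 : ℝ) 0) := by
  simpa using isSemialgebraic_band1 1 0

/-- `[[1, 0], 0]`: the EMPTY band over the point (edges `a = 1 > 0 = b`), value `0`. -/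
def emptyBandRep : KZ.IntegralRep 1 :=
  bandRep 1 0 isSemialgebraic_band1_one_zero (fun _ => 0)
    ((isSemialgebraicFunOn_const isSemialgebraic_band1_one_zero 0).congr fun _ _ => by simp)
    continuousOn_const

theorem value_emptyBandRep : emptyBandRep.value = 0 := by
  simp [KZ.IntegralRep.value, emptyBandRep]

/-- **`a ≤ b` cannot be dropped.** Witness: base `ℝ⁰`, `a = 1`, `b = 0` (empty band, `[r] = [∅, 0]`),
`k = 1`, `h = 1`, `V = exp t` (vacuously semialgebraic on the empty band), so that
`r'.integrand = log V(·,0) − log V(·,1) = −1` is rational: `r' = [pt, −1]`, `r.value = 0 ≠ −1`.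
(With `a ≤ b` the band is non-empty, `V` must be semialgebraic there, and `exp` is excluded.) -/
theorem not_withoutLe : ¬ WithoutLe := by
  intro H
  have hmem := H 0 1 emptyBandRep (ptRep (-1)) (fun _ => 1) (fun _ => 0) (fun _ _ => 1)
    (fun _ z => Real.exp (z 0)) (fun _ z => Real.exp (z 0))
    ((isSemialgebraicFunOn_const isSemialgebraic_univ 1).congr fun _ _ => by simp)
    ((isSemialgebraicFunOn_const isSemialgebraic_univ 0).congr fun _ _ => by simp)
    rfl
    (fun _ => (isSemialgebraicFunOn_const isSemialgebraic_univ 1).congr fun _ _ => by simp)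
    (fun _ => (isSemialgebraicFunOn_const isSemialgebraic_band1_one_zero 0).congr
      fun z hz => (not_mem_band1_one_zero z hz).elim)
    (fun _ z _ => Real.exp_pos _)
    (fun _ x _ => by
      simpa only [snoc_fin_one_apply_zero] using Real.continuous_exp.continuousOn)
    (fun _ x _ t ht => by
      simp only [mem_Ioo] at ht
      exact absurd (ht.1.trans ht.2) (by norm_num))
    (fun _ => by
      rw [show emptyBandRep.domain = ∅ from band1_one_zero_eq_empty]
      exact integrableOn_empty)
    (fun x _ t ht => by
      simp only [mem_Ioo] at ht
      exact absurd (ht.1.trans ht.2) (by norm_num))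
    (fun x _ => by simp)
  have hv := value_eq_of_sub_mem_relations hmem
  rw [value_emptyBandRep, value_ptRep] at hv
  norm_num at hv

/-! ### (b) continuity of `Vᵢ` on the CLOSED fibre is load-bearing -/

theorem isSemialgebraic_band1_zero_one :
    Literature.ModelTheory.ExponentialFields.IsSemialgebraic ℚ (band1 (0 : ℝ) 1) := by
  simpa using isSemialgebraic_band1 0 1

/-- The jump: `V = 1` on `{t < 1}`, `V = 2` on `{1 ≤ t}` (so `V(·, b) = 2` at the endpoint `b = 1`). -/
def jumpV (z : Fin 1 → ℝ) : ℝ := if z 0 < 1 then 1 else 2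

theorem isSemialgebraicFunOn_jumpV : IsSemialgebraicFunOn ℚ (band1 (0 : ℝ) 1) jumpV := by
  have h1 : Literature.ModelTheory.ExponentialFields.IsSemialgebraic ℚ {z : Fin 1 → ℝ | z 0 < 1} := by
    simpa using Literature.ModelTheory.ExponentialFields.isSemialgebraic_setOf_eval_lt (k := ℚ)
      (R := ℝ) (MvPolynomial.X 0 : MvPolynomial (Fin 1) ℚ) (1 : MvPolynomial (Fin 1) ℚ)
  have h2 : Literature.ModelTheory.ExponentialFields.IsSemialgebraic ℚ {z : Fin 1 → ℝ | 1 ≤ z 0} := by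
    simpa using Literature.ModelTheory.ExponentialFields.isSemialgebraic_setOf_eval_le (k := ℚ)
      (R := ℝ) (1 : MvPolynomial (Fin 1) ℚ) (MvPolynomial.X 0 : MvPolynomial (Fin 1) ℚ)
  have hu : band1 (0 : ℝ) 1 = (band1 0 1 ∩ {z | z 0 < 1}) ∪ (band1 0 1 ∩ {z | 1 ≤ z 0}) := by
    ext z
    simp only [mem_union, mem_inter_iff, mem_setOf_eq]
    rcases lt_or_ge (z 0) 1 with h | h <;> tauto
  rw [hu]
  refine IsSemialgebraicFunOn.union
    (isSemialgebraicFunOn_const (isSemialgebraic_band1_zero_one.inter h1) 1)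
    (isSemialgebraicFunOn_const (isSemialgebraic_band1_zero_one.inter h2) 2) ?_ ?_
  · intro z hz
    have : z 0 < 1 := hz.2
    simp [jumpV, this]
  · intro z hz
    have : ¬ z 0 < 1 := not_lt.2 hz.2
    simp [jumpV, this]

/-- `[[0, 1], −1/(1+t)]`, value `−log 2`. -/
def logTwoRep : KZ.IntegralRep 1 :=
  bandRep 0 1 isSemialgebraic_band1_zero_one (fun z => -1 / (1 + z 0))
    ((isSemialgebraicFunOn_aeval_div_aeval isSemialgebraic_band1_zero_one (MvPolynomial.C (-1))
        (1 + MvPolynomial.X 0) fun z hz => by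
          have h := (mem_band1.1 hz).1
          simp only [map_add, map_one, MvPolynomial.aeval_X]
          intro h0; linarith).congr
      fun z _ => by simp)
    (continuousOn_const.div (continuousOn_const.add (continuous_apply 0).continuousOn)
      fun z hz => by have h := (mem_band1.1 hz).1; intro h0; linarith)

theorem value_logTwoRep : logTwoRep.value = -Real.log 2 := by
  have hfc : ContinuousOn (fun t : ℝ => -Real.log (1 + t)) (Icc 0 1) :=
    ((continuousOn_const.add continuousOn_id).log fun t ht h0 => by
      simp only [Pi.add_apply, id_eq] at h0
      linarith [ht.1]).neg
  have hfd : ∀ (x : Fin 0 → ℝ), ∀ t ∈ Ioo (0 : ℝ) 1,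
      HasDerivAt (fun t : ℝ => -Real.log (1 + t)) (-1 / (1 + (Fin.snoc x t : Fin 1 → ℝ) 0)) t := by
    intro x t ht
    have h1 : (1 : ℝ) + t ≠ 0 := by have := ht.1; intro h0; linarith
    have hd : HasDerivAt (fun s : ℝ => -Real.log (1 + s)) (-(1 / (1 + t))) t :=
      (((hasDerivAt_id' t).const_add (1 : ℝ)).log h1).neg
    rw [snoc_fin_one_apply_zero]
    convert hd using 1
    ring
  have e : logTwoRep.value = ∫ z in band1 (0 : ℝ) 1, -1 / (1 + z 0) := rfl
  rw [e, setIntegral_band1_eq (G := fun z : Fin 1 → ℝ => -1 / (1 + z 0)) zero_le_one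
    logTwoRep.integrableOn hfc hfd]
  norm_num

/-- **Continuity on the closed fibre cannot be dropped.** Witness: base `ℝ⁰`, band `[0, 1]`,
`k = 2`: `V₀ = jumpV` (`= 1` on `[0,1)`, `= 2` at `t = 1`; `V₀' = 0` on the open fibre), `h₀ = 1`;
`V₁ = 1 + t`, `V₁' = 1`, `h₁ = −1`. Then `r.integrand = −1/(1+t)` on `(0,1)`, the boundary term is
`(log 2 − log 1) − (log 2 − log 1) = 0` (rational thanks to the jump): `r' = [pt, 0]`, while
`r.value = −log 2 ≠ 0`. A jump of `Vᵢ` at an endpoint shifts the boundary term by `hᵢ log(jump)`. -/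
theorem not_withoutContinuousOn : ¬ WithoutContinuousOn := by
  intro H
  have hmem := H 0 2 logTwoRep (ptRep 0) (fun _ => 0) (fun _ => 1) ![fun _ => 1, fun _ => -1]
    ![jumpV, fun z => 1 + z 0] ![fun _ => 0, fun _ => 1]
    ((isSemialgebraicFunOn_const isSemialgebraic_univ 0).congr fun _ _ => by simp)
    ((isSemialgebraicFunOn_const isSemialgebraic_univ 1).congr fun _ _ => by simp)
    (fun _ _ => zero_le_one)
    rfl
    (by
      refine Fin.forall_fin_two.2 ⟨?_, ?_⟩
      · exact (isSemialgebraicFunOn_const isSemialgebraic_univ 1).congr fun _ _ => by simp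
      · exact (isSemialgebraicFunOn_const isSemialgebraic_univ (-1)).congr fun _ _ => by simp)
    (by
      refine Fin.forall_fin_two.2 ⟨?_, ?_⟩
      · show IsSemialgebraicFunOn ℚ (band1 0 1) jumpV
        exact isSemialgebraicFunOn_jumpV
      · show IsSemialgebraicFunOn ℚ (band1 0 1) (fun z : Fin 1 → ℝ => 1 + z 0)
        exact (isSemialgebraicFunOn_aeval isSemialgebraic_band1_zero_one
          (1 + MvPolynomial.X 0 : MvPolynomial (Fin 1) ℚ)).congr fun z _ => by simp)
    (by
      refine Fin.forall_fin_two.2 ⟨fun z _ => ?_, fun z hz => ?_⟩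
      · simp only [Matrix.cons_val_zero, jumpV]
        split_ifs <;> norm_num
      · have h := (mem_band1.1 hz).1
        simp only [Matrix.cons_val_one]
        show (0 : ℝ) < 1 + z 0
        linarith)
    (by
      refine Fin.forall_fin_two.2 ⟨fun x _ t ht => ?_, fun x _ t ht => ?_⟩
      · simp only [mem_Ioo] at ht
        have hev : (fun s : ℝ => jumpV (Fin.snoc x s : Fin 1 → ℝ)) =ᶠ[nhds t] fun _ => (1 : ℝ) := by
          filter_upwards [Iio_mem_nhds ht.2] with s hs
          have hs' : s < 1 := hs
          simp [jumpV, hs']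
        simpa using (hasDerivAt_const t (1 : ℝ)).congr_of_eventuallyEq hev
      · simpa using ((hasDerivAt_id t).const_add (1 : ℝ)))
    (by
      refine Fin.forall_fin_two.2 ⟨?_, ?_⟩
      · simp
      · have hc : ContinuousOn (fun z : Fin 1 → ℝ => (-1 : ℝ) * 1 / (1 + z 0)) (band1 0 1) :=
          continuousOn_const.div (continuousOn_const.add (continuous_apply 0).continuousOn)
            fun z hz => by have h := (mem_band1.1 hz).1; intro h0; linarith
        show IntegrableOn (fun z : Fin 1 → ℝ => (-1 : ℝ) * 1 / (1 + z 0)) (band1 0 1)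
        exact hc.integrableOn_compact (isCompact_band1 0 1))
    (fun x _ t ht => by
      simp [logTwoRep, Fin.sum_univ_two, jumpV])
    (fun x _ => by
      norm_num [Fin.sum_univ_two, jumpV])
  have hv := value_eq_of_sub_mem_relations hmem
  rw [value_logTwoRep, value_ptRep] at hv
  have h2 := Real.log_pos one_lt_two
  simp at hv
  linarith

/-! ### (c) the derivative hypothesis is load-bearing -/

/-- `[[0, 1], 1]`, value `1`. -/
def oneRep : KZ.IntegralRep 1 :=
  bandRep 0 1 isSemialgebraic_band1_zero_one (fun _ => 1)
    ((isSemialgebraicFunOn_const isSemialgebraic_band1_zero_one 1).congr fun _ _ => by simp)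
    continuousOn_const

theorem value_oneRep : oneRep.value = 1 := by
  have e : oneRep.value = ∫ z in band1 (0 : ℝ) 1, (1 : ℝ) := rfl
  rw [e, setIntegral_band1_eq (G := fun _ : Fin 1 → ℝ => (1 : ℝ)) (f := fun t => t) zero_le_one
    oneRep.integrableOn continuousOn_id (fun x t _ => hasDerivAt_id' t)]
  norm_num

/-- **The derivative hypothesis cannot be dropped.** Witness: base `ℝ⁰`, band `[0, 1]`, `k = 1`,
`h = 1`, `V = 1` but `V' = 1` (not the derivative of `V`): `r = [[0,1], 1]` (value `1`),
`r' = [pt, log 1 − log 1] = [pt, 0]`. -/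
theorem not_withoutHasDerivAt : ¬ WithoutHasDerivAt := by
  intro H
  have hmem := H 0 1 oneRep (ptRep 0) (fun _ => 0) (fun _ => 1) (fun _ _ => 1)
    (fun _ _ => 1) (fun _ _ => 1)
    ((isSemialgebraicFunOn_const isSemialgebraic_univ 0).congr fun _ _ => by simp)
    ((isSemialgebraicFunOn_const isSemialgebraic_univ 1).congr fun _ _ => by simp)
    (fun _ _ => zero_le_one)
    rfl
    (fun _ => (isSemialgebraicFunOn_const isSemialgebraic_univ 1).congr fun _ _ => by simp)
    (fun _ => (isSemialgebraicFunOn_const isSemialgebraic_band1_zero_one 1).congr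
      fun _ _ => by simp)
    (fun _ _ _ => one_pos)
    (fun _ _ _ => continuousOn_const)
    (fun _ => by
      show IntegrableOn (fun _ : Fin 1 → ℝ => (1 : ℝ) * 1 / 1) (band1 0 1)
      exact continuousOn_const.integrableOn_compact (isCompact_band1 0 1))
    (fun x _ t ht => by simp [oneRep])
    (fun x _ => by simp)
  have hv := value_eq_of_sub_mem_relations hmem
  rw [value_oneRep, value_ptRep] at hv
  norm_num at hv

/-! ### (d) the band equation is load-bearing (bookkeeping) -/

theorem isSemialgebraic_band1_five_six :
    Literature.ModelTheory.ExponentialFields.IsSemialgebraic ℚ (band1 (5 : ℝ) 6) := by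
  simpa using isSemialgebraic_band1 5 6

/-- The step `0` on `{t ≤ 1}`, `1` beyond. -/
def stepFun (z : Fin 1 → ℝ) : ℝ := if z 0 ≤ 1 then 0 else 1

theorem stepFun_eq_one {z : Fin 1 → ℝ} (hz : z ∈ band1 (5 : ℝ) 6) : stepFun z = 1 := by
  have h := (mem_band1.1 hz).1
  have : ¬ z 0 ≤ 1 := by intro h'; linarith
  simp [stepFun, this]

/-- `[[5, 6], stepFun] = [[5, 6], 1]`, value `1`; its integrand VANISHES on the would-be band `(0, 1)`. -/
def farRep : KZ.IntegralRep 1 :=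
  bandRep 5 6 isSemialgebraic_band1_five_six stepFun
    (((isSemialgebraicFunOn_const isSemialgebraic_band1_five_six 1).congr fun _ _ => by simp).congr
      fun z hz => (stepFun_eq_one hz).symm)
    (continuousOn_const.congr fun z hz => stepFun_eq_one hz)

theorem value_farRep : farRep.value = 1 := by
  have e : farRep.value = ∫ z in band1 (5 : ℝ) 6, stepFun z := rfl
  rw [e, setIntegral_band1_eq (G := stepFun) (f := fun t => t) (by norm_num) farRep.integrableOn
    continuousOn_id (fun x t ht => by
      rw [stepFun_eq_one (snoc_mem_band1.2 (Ioo_subset_Icc_self ht))]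
      exact hasDerivAt_id' t)]
  norm_num

/-- **The band equation cannot be dropped** (bookkeeping hypothesis). Witness with NO logarithm at
all (`k = 0`): `r = [[5, 6], stepFun]` has integrand `0` on the would-be band `(0, 1)` over the point
and value `1`, `r' = [pt, 0]`. -/
theorem not_withoutDomain : ¬ WithoutDomain := by
  intro H
  have hmem := H 0 0 farRep (ptRep 0) (fun _ => 0) (fun _ => 1) (fun i => i.elim0)
    (fun i => i.elim0) (fun i => i.elim0)
    ((isSemialgebraicFunOn_const isSemialgebraic_univ 0).congr fun _ _ => by simp)
    ((isSemialgebraicFunOn_const isSemialgebraic_univ 1).congr fun _ _ => by simp)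
    (fun _ _ => zero_le_one)
    (fun i => i.elim0) (fun i => i.elim0) (fun i => i.elim0) (fun i => i.elim0) (fun i => i.elim0)
    (fun i => i.elim0)
    (fun x _ t ht => by
      simp only [mem_Ioo] at ht
      have : t ≤ 1 := ht.2.le
      simp [farRep, stepFun, this])
    (fun x _ => by simp)
  have hv := value_eq_of_sub_mem_relations hmem
  rw [value_farRep, value_ptRep] at hv
  norm_num at hv

end Witnesses


/-! ## §5 NOT load-bearing modulo Conjecture 1: the semialgebraicity of `a, b, hᵢ, Vᵢ` and termwise integrability

`Bare` drops ALL of `ha hb hh hV hint` at once (keeping `a ≤ b`, the band equation, `Vᵢ > 0`,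
continuity, the derivative and the two integrand equations). It is still a consequence of the kernel
conjecture, hence of the summit: the dropped hypotheses are not needed for the TRUTH of the
conclusion, only (presumably) for CONSTRUCTING a derivation — every intermediate representation of
the unfolding plan must itself be a `KZ.IntegralRep` (semialgebraic, absolutely integrable). A
counterexample to `Bare` would refute Conjecture 1. -/

/-- The crux with `ha hb hh hV hint` ALL dropped: only the analytic data remain. -/
def Bare : Prop :=
  ∀ (n k : ℕ) (r : KZ.IntegralRep (n + 1)) (r' : KZ.IntegralRep n) (a b : (Fin n → ℝ) → ℝ)
    (h : Fin k → (Fin n → ℝ) → ℝ) (V V' : Fin k → (Fin (n + 1) → ℝ) → ℝ),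
    (∀ x ∈ r'.domain, a x ≤ b x) →
    r.domain = {z | (Fin.init z : Fin n → ℝ) ∈ r'.domain ∧ a (Fin.init z) ≤ z (Fin.last n) ∧
      z (Fin.last n) ≤ b (Fin.init z)} →
    (∀ i, ∀ z ∈ r.domain, 0 < V i z) →
    (∀ i, ∀ x ∈ r'.domain, ContinuousOn (fun t : ℝ => V i (Fin.snoc x t)) (Icc (a x) (b x))) →
    (∀ i, ∀ x ∈ r'.domain, ∀ t ∈ Ioo (a x) (b x),
      HasDerivAt (fun s : ℝ => V i (Fin.snoc x s)) (V' i (Fin.snoc x t)) t) →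
    (∀ x ∈ r'.domain, ∀ t ∈ Ioo (a x) (b x),
      r.integrand (Fin.snoc x t) = ∑ i, h i x * V' i (Fin.snoc x t) / V i (Fin.snoc x t)) →
    (∀ x ∈ r'.domain, r'.integrand x =
      ∑ i, h i x * (Real.log (V i (Fin.snoc x (b x))) - Real.log (V i (Fin.snoc x (a x))))) →
    KZ.of r - KZ.of r' ∈ KZ.relations

/-- `Bare` follows from the kernel conjecture (`eval_sub_eq_zero_of_logData` uses none of the dropped
hypotheses). -/
theorem bare_of_kzKernelConjecture (hK : KZKernelConjecture) : Bare := by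
  intro n k r r' a b h V V' hab hdom hpos hcont hderiv hr hr'
  exact hK _ (eval_sub_eq_zero_of_logData r r' a b h V V' hab hdom hpos hcont hderiv hr hr')

/-- `Bare` follows from the summit. -/
theorem bare_of_summit (hS : _root_.KontsevichZagierPeriods) : Bare :=
  bare_of_kzKernelConjecture (kzKernelConjecture_iff_isRational.mpr hS)

/-- `Bare` is a strengthening of the crux. -/
theorem crux_of_bare (hB : Bare) : LogPrimitiveNL := by
  intro n k r r' a b h V V' _ _ hab hdom _ _ hpos hcont hderiv _ hr hr'
  exact hB n k r r' a b h V V' hab hdom hpos hcont hderiv hr hr'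

/-! ## §6 A natural strengthening that IS false: the logarithmic step is not ONE Newton–Leibniz move

`SingleMove`: same hypotheses, conclusion "there is a `ℚ`-semialgebraic primitive `F` on the band
realising `[r] − [r']` as ONE instance of `KZ.newtonLeibnizRel`". It implies the crux
(`crux_of_singleMove`) and it is FALSE (`not_singleMove`): the kernel element
`f(t) = 2t/(2 − t²) − 1/(2 − t)` of the NARROW barrier
`Literature.Barriers.KontsevichZagierPeriods.KZ.algebraicPrimitivesObstructionNarrow` IS an instance of
the crux — `n = 0`, band `[0, 1]`, `k = 2`, `V₀ = 2 − t²` (`h₀ = −1`), `V₁ = 2 − t` (`h₁ = 1`), boundary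
term `(−1)(log 1 − log 2) + (log 1 − log 2) = 0`, `r' = [pt, 0]` — and it has no `ℚ`-semialgebraic
primitive on `[0, 1]` (`algebraicPrimitivesObstructionNarrow_holds`, with `c = 0`). So any proof of
the crux must CHANGE DIMENSION or use change of variables (here: `[[0,1], 1/(2−t)] ~ [[0,1], 2t/(2−t²)]`
is one move of rule 2), `t ↦ t²`), exactly as the route's unfolding plan does; "Newton–Leibniz with a
cleverer semialgebraic primitive" is excluded already at `n = 0`, `k = 2`. -/

/-- STRENGTHENING of the crux: the logarithmic Newton–Leibniz datum is ONE honest Newton–Leibniz move,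
i.e. admits a `ℚ`-semialgebraic primitive on the band with the right boundary values. -/
def SingleMove : Prop :=
  ∀ (n k : ℕ) (r : KZ.IntegralRep (n + 1)) (r' : KZ.IntegralRep n) (a b : (Fin n → ℝ) → ℝ)
    (h : Fin k → (Fin n → ℝ) → ℝ) (V V' : Fin k → (Fin (n + 1) → ℝ) → ℝ),
    IsSemialgebraicFunOn ℚ r'.domain a →
    IsSemialgebraicFunOn ℚ r'.domain b →
    (∀ x ∈ r'.domain, a x ≤ b x) →
    r.domain = {z | (Fin.init z : Fin n → ℝ) ∈ r'.domain ∧ a (Fin.init z) ≤ z (Fin.last n) ∧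
      z (Fin.last n) ≤ b (Fin.init z)} →
    (∀ i, IsSemialgebraicFunOn ℚ r'.domain (h i)) →
    (∀ i, IsSemialgebraicFunOn ℚ r.domain (V i)) →
    (∀ i, ∀ z ∈ r.domain, 0 < V i z) →
    (∀ i, ∀ x ∈ r'.domain, ContinuousOn (fun t : ℝ => V i (Fin.snoc x t)) (Icc (a x) (b x))) →
    (∀ i, ∀ x ∈ r'.domain, ∀ t ∈ Ioo (a x) (b x),
      HasDerivAt (fun s : ℝ => V i (Fin.snoc x s)) (V' i (Fin.snoc x t)) t) →
    (∀ i, IntegrableOn (fun z => h i (Fin.init z) * V' i z / V i z) r.domain) →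
    (∀ x ∈ r'.domain, ∀ t ∈ Ioo (a x) (b x),
      r.integrand (Fin.snoc x t) = ∑ i, h i x * V' i (Fin.snoc x t) / V i (Fin.snoc x t)) →
    (∀ x ∈ r'.domain, r'.integrand x =
      ∑ i, h i x * (Real.log (V i (Fin.snoc x (b x))) - Real.log (V i (Fin.snoc x (a x))))) →
    ∃ F : (Fin (n + 1) → ℝ) → ℝ, IsSemialgebraicFunOn ℚ r.domain F ∧
      (∀ x ∈ r'.domain, ContinuousOn (fun t : ℝ => F (Fin.snoc x t)) (Icc (a x) (b x))) ∧
      (∀ x ∈ r'.domain, ∀ t ∈ Ioo (a x) (b x),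
        HasDerivAt (fun s : ℝ => F (Fin.snoc x s)) (r.integrand (Fin.snoc x t)) t) ∧
      ∀ x ∈ r'.domain, r'.integrand x = F (Fin.snoc x (b x)) - F (Fin.snoc x (a x))

/-- `SingleMove` implies the crux: the primitive `F` makes `[r] − [r']` an element of
`KZ.newtonLeibnizRel ⊆ KZ.relations`. -/
theorem crux_of_singleMove (hS : SingleMove) : LogPrimitiveNL := by
  intro n k r r' a b h V V' ha hb hab hdom hh hV hpos hcont hderiv hint hr hr'
  obtain ⟨F, hF, hFc, hFd, hFr'⟩ :=
    hS n k r r' a b h V V' ha hb hab hdom hh hV hpos hcont hderiv hint hr hr'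
  exact KZ.newtonLeibnizRel_subset_relations
    ⟨n, r, r', a, b, F, hF, ha, hb, hab, hdom, hFc, hFd, hFr', rfl⟩

section SingleMoveWitness

open Literature.ModelTheory.ExponentialFields (isSemialgebraic_univ)

/-- The barrier's kernel element as a representation: `[[0, 1], 2t/(2 − t²) − 1/(2 − t)]`. -/
def kerRep : KZ.IntegralRep 1 :=
  bandRep 0 1 isSemialgebraic_band1_zero_one
    (fun z => 2 * z 0 / (2 - z 0 ^ 2) - 1 / (2 - z 0))
    ((isSemialgebraicFunOn_aeval_div_aeval isSemialgebraic_band1_zero_one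
        (2 * MvPolynomial.X 0 * (2 - MvPolynomial.X 0) - (2 - MvPolynomial.X 0 ^ 2))
        ((2 - MvPolynomial.X 0 ^ 2) * (2 - MvPolynomial.X 0)) fun z hz => by
          have h0 := (mem_band1.1 hz).1
          have h1 := (mem_band1.1 hz).2
          simp only [map_mul, map_sub, map_pow, MvPolynomial.aeval_X, map_ofNat]
          apply mul_ne_zero <;> nlinarith).congr
      fun z hz => by
        have h0 := (mem_band1.1 hz).1
        have h1 := (mem_band1.1 hz).2
        have h2 : (2 : ℝ) - z 0 ^ 2 ≠ 0 := by nlinarith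
        have h3 : (2 : ℝ) - z 0 ≠ 0 := by intro h; nlinarith
        simp only [map_mul, map_sub, map_pow, MvPolynomial.aeval_X, map_ofNat]
        field_simp)
    (by
      refine ContinuousOn.sub ?_ ?_
      · exact (continuousOn_const.mul (continuous_apply 0).continuousOn).div
          (continuousOn_const.sub ((continuous_apply 0).continuousOn.pow 2))
          fun z hz => by
            have h0 := (mem_band1.1 hz).1
            have h1 := (mem_band1.1 hz).2
            nlinarith
      · exact continuousOn_const.div (continuousOn_const.sub (continuous_apply 0).continuousOn)
          fun z hz => by
            have h1 := (mem_band1.1 hz).2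
            intro h; nlinarith)

theorem band1_eq_setOf (a b : ℝ) : band1 a b = {x : Fin 1 → ℝ | x 0 ∈ Icc a b} := by
  ext z
  simp [mem_band1]

theorem snoc_eq_const (x : Fin 0 → ℝ) (s : ℝ) : (Fin.snoc x s : Fin 1 → ℝ) = fun _ => s := by
  funext i
  rw [Fin.fin_one_eq_zero i]
  exact snoc_fin_one_apply_zero x s

/-- **The single-move strengthening is FALSE** (the barrier's kernel element is a crux instance with
no semialgebraic primitive). -/
theorem not_singleMove : ¬ SingleMove := by
  intro H
  obtain ⟨F, hF, -, hFd, -⟩ := H 0 2 kerRep (ptRep 0) (fun _ => 0) (fun _ => 1)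
    ![fun _ => -1, fun _ => 1]
    ![fun z => 2 - z 0 ^ 2, fun z => 2 - z 0] ![fun z => -2 * z 0, fun _ => -1]
    ((isSemialgebraicFunOn_const isSemialgebraic_univ 0).congr fun _ _ => by simp)
    ((isSemialgebraicFunOn_const isSemialgebraic_univ 1).congr fun _ _ => by simp)
    (fun _ _ => zero_le_one)
    rfl
    (by
      refine Fin.forall_fin_two.2 ⟨?_, ?_⟩
      · exact (isSemialgebraicFunOn_const isSemialgebraic_univ (-1)).congr fun _ _ => by simp
      · exact (isSemialgebraicFunOn_const isSemialgebraic_univ 1).congr fun _ _ => by simp)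
    (by
      refine Fin.forall_fin_two.2 ⟨?_, ?_⟩
      · show IsSemialgebraicFunOn ℚ (band1 0 1) (fun z : Fin 1 → ℝ => 2 - z 0 ^ 2)
        exact (isSemialgebraicFunOn_aeval isSemialgebraic_band1_zero_one
          (2 - MvPolynomial.X 0 ^ 2 : MvPolynomial (Fin 1) ℚ)).congr fun z _ => by simp
      · show IsSemialgebraicFunOn ℚ (band1 0 1) (fun z : Fin 1 → ℝ => 2 - z 0)
        exact (isSemialgebraicFunOn_aeval isSemialgebraic_band1_zero_one
          (2 - MvPolynomial.X 0 : MvPolynomial (Fin 1) ℚ)).congr fun z _ => by simp)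
    (by
      refine Fin.forall_fin_two.2 ⟨fun z hz => ?_, fun z hz => ?_⟩
      · have h0 := (mem_band1.1 hz).1
        have h1 := (mem_band1.1 hz).2
        show (0 : ℝ) < 2 - z 0 ^ 2
        nlinarith
      · have h1 := (mem_band1.1 hz).2
        show (0 : ℝ) < 2 - z 0
        linarith)
    (by
      refine Fin.forall_fin_two.2 ⟨fun x _ => ?_, fun x _ => ?_⟩
      · show ContinuousOn (fun t : ℝ => 2 - (Fin.snoc x t : Fin 1 → ℝ) 0 ^ 2) (Icc 0 1)
        simp only [snoc_fin_one_apply_zero]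
        exact continuousOn_const.sub (continuousOn_id.pow 2)
      · show ContinuousOn (fun t : ℝ => 2 - (Fin.snoc x t : Fin 1 → ℝ) 0) (Icc 0 1)
        simp only [snoc_fin_one_apply_zero]
        exact continuousOn_const.sub continuousOn_id)
    (by
      refine Fin.forall_fin_two.2 ⟨fun x _ t _ => ?_, fun x _ t _ => ?_⟩
      · show HasDerivAt (fun s : ℝ => 2 - (Fin.snoc x s : Fin 1 → ℝ) 0 ^ 2)
          (-2 * (Fin.snoc x t : Fin 1 → ℝ) 0) t
        simp only [snoc_fin_one_apply_zero]
        exact ((hasDerivAt_pow 2 t).const_sub (2 : ℝ)).congr_deriv (by ring)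
      · show HasDerivAt (fun s : ℝ => 2 - (Fin.snoc x s : Fin 1 → ℝ) 0) (-1) t
        simp only [snoc_fin_one_apply_zero]
        exact (hasDerivAt_id' t).const_sub (2 : ℝ))
    (by
      refine Fin.forall_fin_two.2 ⟨?_, ?_⟩
      · have hc : ContinuousOn (fun z : Fin 1 → ℝ => (-1 : ℝ) * (-2 * z 0) / (2 - z 0 ^ 2))
            (band1 0 1) :=
          (continuousOn_const.mul (continuousOn_const.mul (continuous_apply 0).continuousOn)).div
            (continuousOn_const.sub ((continuous_apply 0).continuousOn.pow 2))
            fun z hz => by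
              have h0 := (mem_band1.1 hz).1
              have h1 := (mem_band1.1 hz).2
              nlinarith
        show IntegrableOn (fun z : Fin 1 → ℝ => (-1 : ℝ) * (-2 * z 0) / (2 - z 0 ^ 2)) (band1 0 1)
        exact hc.integrableOn_compact (isCompact_band1 0 1)
      · have hc : ContinuousOn (fun z : Fin 1 → ℝ => (1 : ℝ) * (-1) / (2 - z 0)) (band1 0 1) :=
          continuousOn_const.div (continuousOn_const.sub (continuous_apply 0).continuousOn)
            fun z hz => by
              have h1 := (mem_band1.1 hz).2
              intro h; nlinarith
        show IntegrableOn (fun z : Fin 1 → ℝ => (1 : ℝ) * (-1) / (2 - z 0)) (band1 0 1)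
        exact hc.integrableOn_compact (isCompact_band1 0 1))
    (fun x _ t ht => by
      simp only [mem_Ioo] at ht
      have h2 : (2 : ℝ) - t ^ 2 ≠ 0 := by nlinarith
      have h3 : (2 : ℝ) - t ≠ 0 := by intro h; nlinarith
      simp only [kerRep, integrand_bandRep, snoc_fin_one_apply_zero, Fin.sum_univ_two,
        Matrix.cons_val_zero, Matrix.cons_val_one]
      field_simp
      ring)
    (fun x _ => by
      norm_num [Fin.sum_univ_two])
  -- the primitive `F` contradicts the barrier (with `c = 0`)
  refine Literature.Barriers.KontsevichZagierPeriods.KZ.algebraicPrimitivesObstructionNarrow_holds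
    ⟨0, F, ?_, fun t ht => ?_⟩
  · have hF' : IsSemialgebraicFunOn ℚ (band1 (0 : ℝ) 1) F := hF
    rwa [band1_eq_setOf] at hF'
  · have hd := hFd (fun i => i.elim0) (mem_univ _) t ht
    rw [snoc_eq_const] at hd
    simp only [kerRep, integrand_bandRep] at hd
    refine hd.congr_deriv ?_
    simp only [add_zero]

end SingleMoveWitness


open Summit.KontsevichZagierPeriods.MzvKernelInKZ.Negative (dualMap dualLin dualMap_apply
  dualMap_dualMap hasFDerivAt_dualMap abs_det_dualLin)

/-! ## §6b Calibration datum: no move in place, four moves across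

Datum: `n = 0`, `k = 2`, band `[0, 1]`, `V = (1 + t, 2 − t)`, `V' = (1, −1)`, `h = (1, 1)`,
`r = affRep = [[0,1], 1/(1+t) − 1/(2−t)]`, `r' = [pt, 0]`. -/

/-- `[[0, 1], 1/(1+t)]`. -/
def repA : KZ.IntegralRep 1 :=
  bandRep 0 1 isSemialgebraic_band1_zero_one (fun z => 1 / (1 + z 0))
    ((isSemialgebraicFunOn_aeval_div_aeval isSemialgebraic_band1_zero_one (MvPolynomial.C 1)
        (1 + MvPolynomial.X 0) fun z hz => by
          have h := (mem_band1.1 hz).1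
          simp only [map_add, map_one, MvPolynomial.aeval_X]
          intro h0; linarith).congr
      fun z _ => by simp)
    (continuousOn_const.div (continuousOn_const.add (continuous_apply 0).continuousOn)
      fun z hz => by have h := (mem_band1.1 hz).1; intro h0; linarith)

/-- `[[0, 1], 1/(2−t)]`. -/
def repB : KZ.IntegralRep 1 :=
  bandRep 0 1 isSemialgebraic_band1_zero_one (fun z => 1 / (2 - z 0))
    ((isSemialgebraicFunOn_aeval_div_aeval isSemialgebraic_band1_zero_one (MvPolynomial.C 1)
        (2 - MvPolynomial.X 0) fun z hz => by
          have h := (mem_band1.1 hz).2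
          simp only [map_sub, map_ofNat, MvPolynomial.aeval_X]
          intro h0; linarith).congr
      fun z _ => by simp)
    (continuousOn_const.div (continuousOn_const.sub (continuous_apply 0).continuousOn)
      fun z hz => by have h := (mem_band1.1 hz).2; intro h0; linarith)

/-- `affRep = [[0, 1], 1/(1+t) − 1/(2−t)]`, the band side of the calibration datum. -/
def affRep : KZ.IntegralRep 1 :=
  bandRep 0 1 isSemialgebraic_band1_zero_one (fun z => 1 / (1 + z 0) - 1 / (2 - z 0))
    ((isSemialgebraicFunOn_aeval_div_aeval isSemialgebraic_band1_zero_one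
        ((2 - MvPolynomial.X 0) - (1 + MvPolynomial.X 0))
        ((1 + MvPolynomial.X 0) * (2 - MvPolynomial.X 0)) fun z hz => by
          have h0 := (mem_band1.1 hz).1
          have h1 := (mem_band1.1 hz).2
          simp only [map_mul, map_add, map_sub, map_one, map_ofNat, MvPolynomial.aeval_X]
          apply mul_ne_zero <;> intro h <;> linarith).congr
      fun z hz => by
        have h0 := (mem_band1.1 hz).1
        have h1 := (mem_band1.1 hz).2
        have h2 : (1 : ℝ) + z 0 ≠ 0 := by intro h; linarith
        have h3 : (2 : ℝ) - z 0 ≠ 0 := by intro h; linarith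
        simp only [map_mul, map_add, map_sub, map_one, map_ofNat, MvPolynomial.aeval_X]
        rw [div_sub_div _ _ h2 h3]
        ring)
    (by
      have hA : ContinuousOn (fun z : Fin 1 → ℝ => 1 / (1 + z 0)) (band1 0 1) :=
        continuousOn_const.div (continuousOn_const.add (continuous_apply 0).continuousOn)
          fun z hz => by have h := (mem_band1.1 hz).1; intro h0; linarith
      have hB : ContinuousOn (fun z : Fin 1 → ℝ => 1 / (2 - z 0)) (band1 0 1) :=
        continuousOn_const.div (continuousOn_const.sub (continuous_apply 0).continuousOn)
          fun z hz => by have h := (mem_band1.1 hz).2; intro h0; linarith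
      exact hA.sub hB)

/-- The datum satisfies the hypotheses of the crux; stated as: every consequence one draws from the
crux for it is available — here packaged as the crux's conclusion for this datum following from the
crux (used only as documentation of admissibility; the conclusion is proved outright below). -/
theorem affRep_sub_ptRep_mem_of_crux
    (hc : LogPrimitiveNL) :
    KZ.of affRep - KZ.of (ptRep 0) ∈ KZ.relations := by
  have hu := Literature.ModelTheory.ExponentialFields.isSemialgebraic_univ (k := ℚ) (R := ℝ)
    (ι := Fin 0)
  refine hc 0 2 affRep (ptRep 0) (fun _ => 0) (fun _ => 1) ![fun _ => 1, fun _ => 1]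
    ![fun z => 1 + z 0, fun z => 2 - z 0] ![fun _ => 1, fun _ => -1]
    ((isSemialgebraicFunOn_const hu 0).congr fun _ _ => by simp)
    ((isSemialgebraicFunOn_const hu 1).congr fun _ _ => by simp)
    (fun _ _ => zero_le_one) rfl ?_ ?_ ?_ ?_ ?_ ?_ ?_ ?_
  · refine Fin.forall_fin_two.2 ⟨?_, ?_⟩ <;>
      exact (isSemialgebraicFunOn_const hu 1).congr fun _ _ => by simp
  · refine Fin.forall_fin_two.2 ⟨?_, ?_⟩
    · show IsSemialgebraicFunOn ℚ (band1 0 1) (fun z : Fin 1 → ℝ => 1 + z 0)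
      exact (isSemialgebraicFunOn_aeval isSemialgebraic_band1_zero_one
        (1 + MvPolynomial.X 0 : MvPolynomial (Fin 1) ℚ)).congr fun z _ => by simp
    · show IsSemialgebraicFunOn ℚ (band1 0 1) (fun z : Fin 1 → ℝ => 2 - z 0)
      exact (isSemialgebraicFunOn_aeval isSemialgebraic_band1_zero_one
        (2 - MvPolynomial.X 0 : MvPolynomial (Fin 1) ℚ)).congr fun z _ => by simp
  · refine Fin.forall_fin_two.2 ⟨fun z hz => ?_, fun z hz => ?_⟩
    · have h0 := (mem_band1.1 hz).1
      show (0 : ℝ) < 1 + z 0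
      linarith
    · have h1 := (mem_band1.1 hz).2
      show (0 : ℝ) < 2 - z 0
      linarith
  · refine Fin.forall_fin_two.2 ⟨fun x _ => ?_, fun x _ => ?_⟩
    · show ContinuousOn (fun t : ℝ => 1 + (Fin.snoc x t : Fin 1 → ℝ) 0) (Icc 0 1)
      simp only [snoc_fin_one_apply_zero]
      exact continuousOn_const.add continuousOn_id
    · show ContinuousOn (fun t : ℝ => 2 - (Fin.snoc x t : Fin 1 → ℝ) 0) (Icc 0 1)
      simp only [snoc_fin_one_apply_zero]
      exact continuousOn_const.sub continuousOn_id
  · refine Fin.forall_fin_two.2 ⟨fun x _ t _ => ?_, fun x _ t _ => ?_⟩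
    · show HasDerivAt (fun s : ℝ => 1 + (Fin.snoc x s : Fin 1 → ℝ) 0) 1 t
      simp only [snoc_fin_one_apply_zero]
      exact (hasDerivAt_id' t).const_add (1 : ℝ)
    · show HasDerivAt (fun s : ℝ => 2 - (Fin.snoc x s : Fin 1 → ℝ) 0) (-1) t
      simp only [snoc_fin_one_apply_zero]
      exact (hasDerivAt_id' t).const_sub (2 : ℝ)
  · refine Fin.forall_fin_two.2 ⟨?_, ?_⟩
    · have hc' : ContinuousOn (fun z : Fin 1 → ℝ => (1 : ℝ) * 1 / (1 + z 0)) (band1 0 1) :=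
        continuousOn_const.div (continuousOn_const.add (continuous_apply 0).continuousOn)
          fun z hz => by have h := (mem_band1.1 hz).1; intro h0; linarith
      show IntegrableOn (fun z : Fin 1 → ℝ => (1 : ℝ) * 1 / (1 + z 0)) (band1 0 1)
      exact hc'.integrableOn_compact (isCompact_band1 0 1)
    · have hc' : ContinuousOn (fun z : Fin 1 → ℝ => (1 : ℝ) * (-1) / (2 - z 0)) (band1 0 1) :=
        continuousOn_const.div (continuousOn_const.sub (continuous_apply 0).continuousOn)
          fun z hz => by have h := (mem_band1.1 hz).2; intro h0; linarith
      show IntegrableOn (fun z : Fin 1 → ℝ => (1 : ℝ) * (-1) / (2 - z 0)) (band1 0 1)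
      exact hc'.integrableOn_compact (isCompact_band1 0 1)
  · intro x _ t ht
    simp only [mem_Ioo] at ht
    have h2 : (1 : ℝ) + t ≠ 0 := by intro h; linarith
    have h3 : (2 : ℝ) - t ≠ 0 := by intro h; linarith
    simp only [affRep, integrand_bandRep, snoc_fin_one_apply_zero, Fin.sum_univ_two,
      Matrix.cons_val_zero, Matrix.cons_val_one]
    field_simp
    ring
  · intro x _
    norm_num [Fin.sum_univ_two]

/-! ### no move in place -/

open Polynomial in
/-- **No `ℚ`-semialgebraic primitive of `1/(1+t) − 1/(2−t)` on `[0, 1]`** (simple pole at `t = 2`,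
residue `−1 ≠ 0`: `(X − 2)(X + 1) · g' = 2X − 1`, `(2X − 1)(2) = 3 ≠ 0`; descent of
`NoSemialgPrimKernel.eq_zero_of_evalEval_eq_zero`). Hence the calibration datum is not a single
Newton–Leibniz move. -/
theorem no_semialgebraic_primitive_affRep :
    ¬ ∃ F : (Fin 1 → ℝ) → ℝ, IsSemialgebraicFunOn ℚ {x | x 0 ∈ Icc (0 : ℝ) 1} F ∧
      ∀ t ∈ Ioo (0 : ℝ) 1, HasDerivAt (fun s : ℝ => F (fun _ => s)) (1 / (1 + t) - 1 / (2 - t)) t := by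
  rintro ⟨F, hF, hderiv⟩
  obtain ⟨P, hP0, hPv⟩ :=
    Literature.Barriers.KontsevichZagierPeriods.KZ.NoSemialgPrimKernel.exists_ne_zero_evalEval_eq_zero hF
  have hV : (X + C (1 : ℝ) : ℝ[X]).eval 2 ≠ 0 := by norm_num
  have hN : (C (2 : ℝ) * X - C 1 : ℝ[X]).eval 2 ≠ 0 := by norm_num
  have hDN : ∀ t ∈ Ioo (0 : ℝ) 1,
      ((X - C (2 : ℝ)) * (X + C 1)).eval t * (1 / (1 + t) - 1 / (2 - t))
        = (C (2 : ℝ) * X - C 1 : ℝ[X]).eval t := by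
    intro t ht
    have h2 : (1 : ℝ) + t ≠ 0 := by have := ht.1; intro h; linarith
    have h3 : (2 : ℝ) - t ≠ 0 := by have := ht.2; intro h; linarith
    simp only [eval_mul, eval_add, eval_sub, eval_X, eval_C]
    field_simp
    ring
  exact hP0 (Literature.Barriers.KontsevichZagierPeriods.KZ.NoSemialgPrimKernel.eq_zero_of_evalEval_eq_zero
    (G := fun s : ℝ => F fun _ => s) hderiv hDN hV hN P.natDegree P le_rfl
    (fun t ht => hPv t (Ioo_subset_Icc_self ht)))

/-! ### four moves across -/

/-- In dimension `1` the reflection reads `(dualMap 1 x)₀ = 1 − x₀`. -/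
theorem dualMap_one_apply_zero (x : Fin 1 → ℝ) : dualMap 1 x 0 = 1 - x 0 := by
  rw [dualMap_apply]
  rfl

/-- The reflection `t ↦ 1 − t` maps `[0, 1]` into itself. -/
theorem dualMap_mem_band1 {x : Fin 1 → ℝ} (hx : x ∈ band1 (0 : ℝ) 1) :
    dualMap 1 x ∈ band1 (0 : ℝ) 1 := by
  have h := mem_band1.1 hx
  rw [mem_band1, dualMap_one_apply_zero]
  constructor <;> linarith [h.1, h.2]

/-- The reflection maps `[0, 1]` onto itself. -/
theorem image_dualMap_band1 : dualMap 1 '' band1 (0 : ℝ) 1 = band1 (0 : ℝ) 1 := by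
  apply Subset.antisymm
  · rintro _ ⟨x, hx, rfl⟩
    exact dualMap_mem_band1 hx
  · intro x hx
    exact ⟨dualMap 1 x, dualMap_mem_band1 hx, dualMap_dualMap x⟩

/-- The reflection is a polynomial map over `ℚ`, hence `ℚ`-semialgebraic on `[0, 1]`. -/
theorem isSemialgebraicMapOn_dualMap_band1 : IsSemialgebraicMapOn ℚ (band1 (0 : ℝ) 1) (dualMap 1) := by
  have h := isSemialgebraicMapOn_aeval isSemialgebraic_band1_zero_one
    (fun j : Fin 1 => (1 - MvPolynomial.X (Fin.rev j) : MvPolynomial (Fin 1) ℚ))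
  refine h.congr fun x _ => ?_
  funext j
  simp [dualMap_apply]

/-- **Move 2 (rule 2).** `[[0,1], 1/(1+t)] − [[0,1], 1/(2−u)] ∈ changeOfVariablesRel` along
`u = 1 − t` (`|det| = 1`). -/
theorem repA_sub_repB_mem_changeOfVariablesRel :
    KZ.of repA - KZ.of repB ∈ KZ.changeOfVariablesRel :=
  ⟨1, repA, repB, dualMap 1, fun _ => dualLin 1, isSemialgebraicMapOn_dualMap_band1,
    fun x _ => (hasFDerivAt_dualMap x).hasFDerivWithinAt,
    fun x _ y _ h => by rw [← dualMap_dualMap x, ← dualMap_dualMap y, h],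
    image_dualMap_band1.symm,
    fun x _ => by
      show 1 / (1 + x 0) = 1 / (2 - dualMap 1 x 0) * |(dualLin 1).det|
      rw [abs_det_dualLin, mul_one, dualMap_one_apply_zero]
      congr 1
      ring,
    rfl⟩

/-- **Move 1 (rule 1b).** `[r] − [[0,1], 1/(1+t)] − [[0,1], −1/(2−t)] ∈ integrandAddRel`. -/
theorem affRep_sub_sub_mem_integrandAddRel :
    KZ.of affRep - KZ.of repA - KZ.of repB.neg ∈ KZ.integrandAddRel :=
  ⟨1, affRep, repA, repB.neg, rfl, rfl, fun x _ => by
    show 1 / (1 + x 0) - 1 / (2 - x 0) = 1 / (1 + x 0) + -(1 / (2 - x 0))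
    ring, rfl⟩

/-- **The crux HOLDS on the calibration datum**: `[affRep] − [pt, 0] ∈ KZ.relations`, by four move
instances (integrand additivity, the reflection `t ↦ 1 − t`, free cancellation `[σ,f] + [σ,−f]`,
and `[pt, 0]`), although no single Newton–Leibniz move does it
(`no_semialgebraic_primitive_affRep`). -/
theorem affRep_sub_ptRep_mem_relations : KZ.of affRep - KZ.of (ptRep 0) ∈ KZ.relations := by
  have h1 : KZ.of affRep - KZ.of repA - KZ.of repB.neg ∈ KZ.relations :=
    KZ.integrandAddRel_subset_relations affRep_sub_sub_mem_integrandAddRel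
  have h2 : KZ.of repA - KZ.of repB ∈ KZ.relations :=
    KZ.changeOfVariablesRel_subset_relations repA_sub_repB_mem_changeOfVariablesRel
  have h3 : KZ.of repB + KZ.of repB.neg ∈ KZ.relations :=
    KZ.levelRel_le_relations (KZ.of_add_of_neg_mem_levelRel repB)
  have h4 : KZ.of (ptRep 0) ∈ KZ.relations :=
    KZ.levelRel_le_relations (KZ.of_mem_levelRel_of_eqOn_zero (ptRep 0) fun x _ => by simp)
  have e : KZ.of affRep - KZ.of (ptRep 0) =
      (KZ.of affRep - KZ.of repA - KZ.of repB.neg) + (KZ.of repA - KZ.of repB) +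
        (KZ.of repB + KZ.of repB.neg) - KZ.of (ptRep 0) := by
    abel
  rw [e]
  exact KZ.relations.sub_mem (KZ.relations.add_mem (KZ.relations.add_mem h1 h2) h3) h4


/-! ### §5b The sign in `hpos` is immaterial -/

/-- The crux with `0 < Vᵢ` replaced by `Vᵢ < 0` on the band. -/
def NegV : Prop :=
  ∀ (n k : ℕ) (r : KZ.IntegralRep (n + 1)) (r' : KZ.IntegralRep n) (a b : (Fin n → ℝ) → ℝ)
    (h : Fin k → (Fin n → ℝ) → ℝ) (V V' : Fin k → (Fin (n + 1) → ℝ) → ℝ),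
    IsSemialgebraicFunOn ℚ r'.domain a →
    IsSemialgebraicFunOn ℚ r'.domain b →
    (∀ x ∈ r'.domain, a x ≤ b x) →
    r.domain = {z | (Fin.init z : Fin n → ℝ) ∈ r'.domain ∧ a (Fin.init z) ≤ z (Fin.last n) ∧
      z (Fin.last n) ≤ b (Fin.init z)} →
    (∀ i, IsSemialgebraicFunOn ℚ r'.domain (h i)) →
    (∀ i, IsSemialgebraicFunOn ℚ r.domain (V i)) →
    (∀ i, ∀ z ∈ r.domain, V i z < 0) →
    (∀ i, ∀ x ∈ r'.domain, ContinuousOn (fun t : ℝ => V i (Fin.snoc x t)) (Icc (a x) (b x))) →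
    (∀ i, ∀ x ∈ r'.domain, ∀ t ∈ Ioo (a x) (b x),
      HasDerivAt (fun s : ℝ => V i (Fin.snoc x s)) (V' i (Fin.snoc x t)) t) →
    (∀ i, IntegrableOn (fun z => h i (Fin.init z) * V' i z / V i z) r.domain) →
    (∀ x ∈ r'.domain, ∀ t ∈ Ioo (a x) (b x),
      r.integrand (Fin.snoc x t) = ∑ i, h i x * V' i (Fin.snoc x t) / V i (Fin.snoc x t)) →
    (∀ x ∈ r'.domain, r'.integrand x =
      ∑ i, h i x * (Real.log (V i (Fin.snoc x (b x))) - Real.log (V i (Fin.snoc x (a x))))) →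
    KZ.of r - KZ.of r' ∈ KZ.relations

/-- **The crux implies its negative-sign twin** (`V ↦ −V`, `V' ↦ −V'`; `Real.log (−v) = Real.log v`,
`h(−V')/(−V) = hV'/V`): only `Vᵢ ≠ 0` on the closed fibres carries content in `hpos`. (Zeros of a
semialgebraic `Vᵢ` inside a fibre with `hᵢ(x) ≠ 0` are excluded anyway by `hint`: near a zero of
order `α > 0`, `Vᵢ'/Vᵢ ~ α/(t − t₀)` is not integrable.) -/
theorem negV_of_crux (hc : LogPrimitiveNL) : NegV := by
  intro n k r r' a b h V V' ha hb hab hdom hh hV hneg hcont hderiv hint hr hr'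
  have hfun : ∀ i, (fun z : Fin (n + 1) → ℝ => h i (Fin.init z) * -V' i z / -V i z) =
      fun z => h i (Fin.init z) * V' i z / V i z :=
    fun i => funext fun z => by rw [mul_neg, neg_div_neg_eq]
  refine hc n k r r' a b h (fun i z => -V i z) (fun i z => -V' i z) ha hb hab hdom hh
    (fun i => ?_) (fun i z hz => neg_pos.2 (hneg i z hz)) (fun i x hx => (hcont i x hx).neg)
    (fun i x hx t ht => (hderiv i x hx t ht).neg) (fun i => ?_) (fun x hx t ht => ?_) (fun x hx => ?_)
  · show IsSemialgebraicFunOn ℚ r.domain (fun z => -V i z)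
    exact (hV i).neg
  · show IntegrableOn (fun z : Fin (n + 1) → ℝ => h i (Fin.init z) * -V' i z / -V i z) r.domain
    rw [hfun i]
    exact hint i
  · rw [hr x hx t ht]
    exact Finset.sum_congr rfl fun i _ => by rw [mul_neg, neg_div_neg_eq]
  · simp only [Real.log_neg_eq_log]
    exact hr' x hx

/-! ## §7 Why the crux resists, and what a proof must do (analysis)

1. NO VALUE GAP. §1–§2: every admissible datum is a kernel element, so `KZ.eval` cannot separate
   `[r]` from `[r']`; the tree has no other invariant of `KZ.relations` — the Nori symbol
   `KZ.noriSymbol Ψ` of `KZNoriSymbol.lean` kills `relations` too (`relations_le_ker_noriSymbol`) but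
   is a HYPOTHESIS structure (`KZ.NoriSymbolData`, not constructed), and the unfolded logarithmic
   identities are geometric (motivic) anyway, so no "non-motivic" separation is expected either.

2. THE ENGINE IS ALREADY IN THE TREE. `KZLogCalculusProofs.lean` PROVES `KZlog.Conservative_holds`
   and, on the way, the unfolded logarithmic Stokes formula `KZ.unfoldedLogStokes_mem_relations`
   (one monomial `H log V`, `V ≥ 1`, `H', V'` semialgebraic ON the band: `[band, H V'/V] + [W] −
   [U_b] − [U_a] ∈ relations` with `W = [{1 ≤ w ≤ V}, H'/w]`, `U_b = [{1 ≤ u ≤ V(·,b)}, H(·,b)/u]`,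
   `U_a = [{1 ≤ u ≤ V(·,a)}, −H(·,a)/u]`), the fibrewise substitution
   `KZ.of_sub_of_mem_relations_fibreSubst` (`[{1 ≤ s ≤ v}, f/s] ∼ [{0 ≤ θ ≤ 1}, f(v−1)/(1+θ(v−1))]`),
   the affine substitution `KZ.of_sub_of_mem_relations_of_affine` and the unfolded product rule
   `KZ.of_sub_of_sub_mem_relations_mul` (`[{1 ≤ t ≤ uw}, g/t] ∼ [{1 ≤ t ≤ u}, g/t] + [{1 ≤ s ≤ w}, g/s]`,
   hence powers). With `H = hᵢ ∘ init` (`H' = 0`, so `[W] ∈ relations`) the engine turns the crux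
   into a statement about the BASE only. Two wrinkles a prover meets when instantiating it:
   (a) `V'` is not assumed semialgebraic in the crux — use the honest `t`-derivative, semialgebraic
   where it exists (`SemialgebraicDerivative.lean`, BPR Prop. 3.22, named facts
   `IsSemialgebraicFunOn.hasDerivAt_last_isSemialgebraic`), and discard the graphs of `a, b` (null);
   (b) INTEGRABILITY OF THE BOUNDARY MONOMIALS IS NOT AUTOMATIC: the crux only gives
   `hᵢ·(log Bᵢ − log Aᵢ) ∈ L¹(τ)` (`Aᵢ = Vᵢ(·,a)`, `Bᵢ = Vᵢ(·,b)`; indeed `|hᵢ| |log(Bᵢ/Aᵢ)| ≤ ∫|hᵢVᵢ'/Vᵢ| dt`),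
   not `hᵢ log Bᵢ ∈ L¹`. TRAP INSTANCE (valid, `n = 1`): `τ = (0,1)`, band `t ∈ [0,1]`,
   `h = (1/x², −1/x²)`, `V₁ = (1 + x³t)/x`, `V₂ = (1 + x³t²)/x` (`hᵢVᵢ'/Vᵢ = x/(1+x³t), −2xt/(1+x³t²)`,
   bounded; boundary term `0`; the crux holds here by ONE fibrewise move `t ↦ t²`), but the naive
   boundary monomial `[{0<x<1, 1 ≤ u ≤ (1+x³)/x}, x⁻²/u]` has infinite mass `∫ x⁻² log((1+x³)/x) = ∞`
   and is NOT a `KZ.IntegralRep`. REMEDY: renormalise `Vᵢ ↦ Vᵢ/Aᵢ` fibrewise (same `Vᵢ'/Vᵢ`, the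
   `a`-side monomial disappears, `|hᵢ log(Bᵢ/Aᵢ)|` is integrable), then split `τ × fibres` along
   `{Vᵢ = Aᵢ}` to restore `V ≥ 1` (`log v = log⁺v − log⁺(1/v)`), everything "smooth off a null set"
   as in `KZLogCalculusProofs.lean` (no cylindrical decomposition needed).

3. THE RESIDUAL CONTENT = BOUNDARY RIGIDITY (typed as `BoundaryRigidity`, §8): for semialgebraic
   `hᵢ`, `Wᵢ ≥ 1` on `τ` such that the FUNCTION `g = Σ hᵢ log Wᵢ` is the integrand of an honest
   representation, `Σᵢ [{x ∈ τ, 1 ≤ u ≤ Wᵢ x}, hᵢ x/u] − [τ, g] ∈ KZ.relations` — i.e. the SEMANTIC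
   identification `[τ; 0; (hᵢ, Wᵢ)ᵢ] ≡ incl [τ, g]` that `KZlog` deliberately does not have as a move
   ("constants collapse", `KZLogCalculus.lean` header), restricted to terms whose function happens
   to be semialgebraic. Modulo the tree engine, `LogPrimitiveNL` and `BoundaryRigidity` are
   equivalent (crux ⇒ BR: take `a = 0`, `b = 1`, `Vᵢ = 1 + t(Wᵢ − 1)` and `fibreSubst`; BR ⇒ crux:
   item 2). BR is where the transcendence lives, and it is PLAUSIBLY TRUE with all ingredients in
   the tree: on a cell where `hᵢ, Wᵢ, g` are Nash (`IsSemialgebraicFunOn.exists_contDiffOn_holds`),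
   Ax's theorem (`ax_schanuel_holds`, PROVED — `RosenlichtProp4Residues.lean`; derivations `∂/∂xⱼ`
   of the Nash function field, constants `ℝ`) says `1, log W₁, …, log W_s` are linearly independent
   over the algebraic functions as soon as the `Wᵢ` are multiplicatively independent modulo
   constants; eliminating the dependent `log Wⱼ` through `Wⱼ^N = cⱼ ∏ Wᵢ^{m_ji}` (constants `cⱼ`
   ALGEBRAIC, being constant `ℚ`-semialgebraic functions) leaves `g = Σ_l H_l(x) λ_l`,
   `H_l ∈ span_ℚ(hᵢ)` semialgebraic, `λ_l` ℚ-independent logarithms of algebraic numbers; at every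
   algebraic point Baker (`baker_holds`, PROVED) forces `H_l(x) = 0 = g(x)`, so by density `g = 0`,
   `H_l = 0` on the cell. Hence (i) EVERY admissible `r'` of the crux has integrand `0` a.e. and
   `[r'] ∈ relations` (`KZ.of_mem_relations_of_volume_eq_zero`, `…_of_eqOn_zero`), and (ii) the
   vanishing of `Σ [Uᵢ]` is GENERATED by multiplicative identities among semialgebraic functions /
   algebraic numbers and ℚ-linear identities among the `hᵢ`, each realised by the move templates of
   item 2 (product rule ⇒ powers, the exponent `N` being removed by integer division
   `mem_relations_of_nsmul_mem_relations` of the sibling's Torsion.lean; `{1 ≤ u ≤ c}` with `c` an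
   algebraic NUMBER is an honest fibre).
   The refuter found no regime where (ii) could fail: Baker says precisely that `ℚ̄`-linear relations
   among logarithms of algebraic numbers come from ℚ-multiplicative ones, Ax the same for functions.

4. THE `n = 0` CASE is Baker-complete, and its negative half is PROVED here (§9):
   `dimZero_boundary_eq_zero` — every admissible `r'` over the point has integrand `0`
   (`baker_sum_eq_zero`, from `baker_holds`), so `[r'] ∈ relations` (`dimZero_base_mem_relations`)
   and `DimZero` (§8b) is exactly "`[r] ∈ relations` for every admissible band datum over the point".
   RECIPE for the positive half (prover's first milestone): renormalise `Vᵢ ↦ Vᵢ/Aᵢ` and split the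
   fibre along `{Vᵢ = Aᵢ}` to get `V ≥ 1` pieces; `KZ.unfoldedLogStokes_mem_relations` with
   `H = hᵢ` (constant), `H' = 0` turns `[r]` into `Σᵢ [{1 ≤ u ≤ Wᵢ}, hᵢ/u]`, `Wᵢ = Bᵢ/Aᵢ` algebraic
   NUMBERS with `Σ hᵢ log Wᵢ = 0`; by Baker again the `ℚ̄`-relation vector `(hᵢ)` is a
   `ℚ̄`-combination `Σ_l c_l m^{(l)}` of INTEGER relation vectors (`Π Wᵢ^{mᵢ^{(l)}} = 1`); integrand
   additivity splits accordingly, the algebraic constants `c_l` are carried by the scaling map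
   `KZ.scale` of `Cruxes/MzvKernelInKZ/Disproof.lean` §Scaling (relations-preserving), and each
   integer relation `Σᵢ mᵢ [{1 ≤ u ≤ Wᵢ}, 1/u] ∈ relations` is the unfolded product rule
   `KZ.of_sub_of_sub_mem_relations_mul` (positive against negative exponents) plus integer division
   `mem_relations_of_nsmul_mem_relations`. §6b is the smallest non-trivial certificate (`k = 2`, one
   reflection instead of the product rule).

5. REGIMES TRIED WITHOUT EFFECT (so nobody repeats them): `k = 0` (both sides zero/NL with
   `F = 0`); `k = 1` (admissible only if `h·log W` semialgebraic ⇒ `W = 1` where `h ≠ 0`); empty base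
   (`KZ.IntegralRep.of_empty_mem_relations`); `a = b` (null band, `r' = [τ, 0]`); jump / kink /
   non-derivative data (killed only when the corresponding hypothesis is dropped, §4); sign of `V`
   (§5b); termwise non-integrable but summable integrands (values still agree, §5); non-integrable
   boundary monomials (item 2(b): a trap for the PLAN, not a counterexample to the STATEMENT).
-/

/-! ## §8 The residual target, typed, and its necessity -/

/-- **BOUNDARY RIGIDITY** (the residual content of the crux modulo the tree engine, §7.3): over a
`ℚ`-semialgebraic base (`g.domain`), for `ℚ`-semialgebraic `hᵢ` and `Wᵢ ≥ 1`, if the FUNCTION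
`Σᵢ hᵢ · log Wᵢ` is the integrand of an honest representation `g`, then the unfolded monomials
`Uᵢ = [{(x,u) | x ∈ g.domain, 1 ≤ u ≤ Wᵢ x}, hᵢ x/u]` satisfy `Σᵢ [Uᵢ] − [g] ∈ KZ.relations`.
`LogPrimitiveNL ⇒ BoundaryRigidity` by `KZ.of_sub_of_mem_relations_fibreSubst` (take `a = 0`, `b = 1`,
`Vᵢ = 1 + t (Wᵢ − 1)`); `BoundaryRigidity ⇒ LogPrimitiveNL` by `KZ.unfoldedLogStokes_mem_relations`
after the renormalisation of §7.2(b). Expected TRUE (Ax–Schanuel + Baker, both proved in tree). -/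
def BoundaryRigidity : Prop :=
  ∀ (n k : ℕ) (g : KZ.IntegralRep n) (h W : Fin k → (Fin n → ℝ) → ℝ)
    (U : Fin k → KZ.IntegralRep (n + 1)),
    (∀ i, IsSemialgebraicFunOn ℚ g.domain (h i)) →
    (∀ i, IsSemialgebraicFunOn ℚ g.domain (W i)) →
    (∀ i, ∀ x ∈ g.domain, 1 ≤ W i x) →
    (∀ i, (U i).domain = {z | (Fin.init z : Fin n → ℝ) ∈ g.domain ∧ 1 ≤ z (Fin.last n) ∧
      z (Fin.last n) ≤ W i (Fin.init z)}) →
    (∀ i, EqOn (U i).integrand (fun z => h i (Fin.init z) / z (Fin.last n)) (U i).domain) →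
    (∀ i, IntegrableOn (fun x => h i x * Real.log (W i x)) g.domain) →
    (∀ x ∈ g.domain, g.integrand x = ∑ i, h i x * Real.log (W i x)) →
    ∑ i, KZ.of (U i) - KZ.of g ∈ KZ.relations

/-- **The crux implies boundary rigidity** (so a counterexample to `BoundaryRigidity` refutes the
crux, and the typed target is not stronger than the crux). Given BR data, the crux is applied to the
band `g.domain × [0, 1]` with `Vᵢ(x, t) = 1 + t (Wᵢ x − 1)` (`Vᵢ' = Wᵢ − 1`, `hᵢVᵢ'/Vᵢ` = the box
integrand of `KZ.isSemialgebraicFunOn_box₁` / `KZ.integrableOn_box₁`), whose boundary term is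
`Σ hᵢ log Wᵢ = g.integrand`; the band representation `[box, Σᵢ hᵢ(Wᵢ−1)/(1+t(Wᵢ−1))]` is split into
its summands (`KZ.of_sub_of_sub_sum_mem_relations`) and each summand is carried onto the unfolded
monomial `Uᵢ` by the fibrewise substitution `KZ.of_sub_of_mem_relations_fibreSubst` (tree engine). -/
theorem boundaryRigidity_of_crux (hc : LogPrimitiveNL) : BoundaryRigidity := by
  intro n k g h W U hh hW hW1 hUd hUi hUint hg
  have hS : Literature.ModelTheory.ExponentialFields.IsSemialgebraic ℚ g.domain :=
    g.isSemialgebraic_domain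
  have hSm : MeasurableSet g.domain := KZ.IntegralRep.measurableSet_domain_holds g
  -- `cᵢ = Wᵢ − 1 ≥ 0`
  have hcsa : ∀ i, IsSemialgebraicFunOn ℚ g.domain (fun x => W i x - 1) := fun i =>
    (IsSemialgebraicFunOn.sub_holds (hW i) (isSemialgebraicFunOn_ratCast hS 1)).congr
      fun x _ => by simp
  have hc0 : ∀ i, ∀ x ∈ g.domain, 0 ≤ W i x - 1 := fun i x hx => sub_nonneg.2 (hW1 i x hx)
  -- the box over the base
  have hQ : Literature.ModelTheory.ExponentialFields.IsSemialgebraic ℚ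
      (KZlog.band g.domain (fun _ => (0 : ℝ)) (fun _ => 1)) :=
    KZlog.isSemialgebraic_band (by simpa using isSemialgebraicFunOn_ratCast hS 0)
      (by simpa using isSemialgebraicFunOn_ratCast hS 1)
  have hlogint : ∀ i, IntegrableOn (fun y => h i y * Real.log (1 + (W i y - 1))) g.domain :=
    fun i => (hUint i).congr_fun (fun y _ => by simp) hSm
  -- the box representations `R₂ i = [box, hᵢ cᵢ/(1 + t cᵢ)]`
  let R₂ : Fin k → KZ.IntegralRep (n + 1) := fun i =>
    { domain := KZlog.band g.domain (fun _ => (0 : ℝ)) (fun _ => 1)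
      integrand := fun w => h i (Fin.init w) * (W i (Fin.init w) - 1) /
        (1 + w (Fin.last n) * (W i (Fin.init w) - 1))
      isSemialgebraic_domain := hQ
      isSemialgebraicFunOn_integrand := KZ.isSemialgebraicFunOn_box₁ hS (hh i) (hcsa i) (hc0 i)
      integrableOn := KZ.integrableOn_box₁ hS (hh i) (hcsa i) (hc0 i) (hlogint i) }
  -- fibrewise substitution, termwise (tree engine)
  have hfs : ∀ i, KZ.of (U i) - KZ.of (R₂ i) ∈ KZ.relations := fun i =>
    KZ.of_sub_of_mem_relations_fibreSubst hS (hW i) (hW1 i) (U i) (R₂ i) (hUd i) (hUi i) rfl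
      fun w _ => rfl
  -- the band representation of the crux instance and its splitting
  let r : KZ.IntegralRep (n + 1) :=
    { domain := KZlog.band g.domain (fun _ => (0 : ℝ)) (fun _ => 1)
      integrand := fun w => ∑ i, (R₂ i).integrand w
      isSemialgebraic_domain := hQ
      isSemialgebraicFunOn_integrand :=
        KZ.isSemialgebraicFunOn_finset_sum _ hQ fun i _ => (R₂ i).isSemialgebraicFunOn_integrand
      integrableOn := integrable_finsetSum _ fun i _ => (R₂ i).integrableOn }
  obtain ⟨z0, hz0d, hz0i⟩ := KZ.exists_zeroRep hQ
  have hsplit : KZ.of r - KZ.of z0 - ∑ i, KZ.of (R₂ i) ∈ KZ.relations :=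
    KZ.of_sub_of_sub_sum_mem_relations k r z0 R₂ hz0d (fun _ => rfl) fun w _ => by
      simp [hz0i, r]
  have hz0 : KZ.of z0 ∈ KZ.relations :=
    KZ.of_mem_relations_of_eqOn_zero z0 fun w _ => by simp [hz0i]
  -- the crux, applied with `Vᵢ = 1 + t (Wᵢ − 1)`, `Vᵢ' = Wᵢ − 1`, `a = 0`, `b = 1`
  have hcrux : KZ.of r - KZ.of g ∈ KZ.relations := by
    refine hc n k r g (fun _ => 0) (fun _ => 1) h
      (fun i z => 1 + z (Fin.last n) * (W i (Fin.init z) - 1)) (fun i z => W i (Fin.init z) - 1)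
      (by simpa using isSemialgebraicFunOn_ratCast hS 0)
      (by simpa using isSemialgebraicFunOn_ratCast hS 1)
      (fun _ _ => zero_le_one) rfl hh (fun i => ?_) (fun i z hz => ?_) (fun i x _ => ?_)
      (fun i x _ t _ => ?_) (fun i => (R₂ i).integrableOn) (fun x _ t _ => ?_) (fun x hx => ?_)
    · exact (IsSemialgebraicFunOn.add_holds (isSemialgebraicFunOn_ratCast hQ 1)
        (IsSemialgebraicFunOn.mul_holds (isSemialgebraicFunOn_apply hQ (Fin.last n))
          ((hcsa i).comp_init_mono hQ KZ.band_subset_setOf_init_mem))).congr fun w _ => by simp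
    · have h0 : 0 ≤ z (Fin.last n) := hz.2.1
      have h1 : 0 ≤ W i (Fin.init z) - 1 := hc0 i _ hz.1
      show 0 < 1 + z (Fin.last n) * (W i (Fin.init z) - 1)
      positivity
    · simp only [Fin.snoc_last, Fin.init_snoc]
      exact continuousOn_const.add (continuousOn_id.mul continuousOn_const)
    · simp only [Fin.snoc_last, Fin.init_snoc]
      exact (((hasDerivAt_id' t).mul_const (W i x - 1)).const_add 1).congr_deriv (by ring)
    · simp [r, R₂]
    · rw [hg x hx]
      refine Finset.sum_congr rfl fun i _ => ?_
      simp
  -- assembly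
  have hA : ∑ i, (KZ.of (U i) - KZ.of (R₂ i)) ∈ KZ.relations :=
    AddSubgroup.sum_mem _ fun i _ => hfs i
  have e : ∑ i, KZ.of (U i) - KZ.of g =
      (∑ i, (KZ.of (U i) - KZ.of (R₂ i))) - (KZ.of r - KZ.of z0 - ∑ i, KZ.of (R₂ i)) +
        (KZ.of r - KZ.of g) - KZ.of z0 := by
    rw [Finset.sum_sub_distrib]
    abel
  rw [e]
  exact KZ.relations.sub_mem (KZ.relations.add_mem (KZ.relations.sub_mem hA hsplit) hcrux) hz0



/-! ## §8b First milestone, typed: the crux over the one-point base (`n = 0`) -/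

/-- The crux in dimension `n = 0` (base `ℝ⁰`, band `⊂ ℝ¹`): `hᵢ`, `a`, `b` are (algebraic) constants,
`Vᵢ` semialgebraic functions of `t`; by §7.4 its content is Baker's theorem plus the product-rule
template in dimension `1` (and §6b is its smallest non-trivial instance). A prover's first milestone;
`dimZero_of_crux` records that it is a special case. MILESTONE, NOT A HYPOTHESIS: a file assuming
`DimZero` proves nothing about the crux (D-0026); only the direction crux ⇒ `DimZero` is recorded. -/
def DimZero : Prop :=
  ∀ (k : ℕ) (r : KZ.IntegralRep 1) (r' : KZ.IntegralRep 0) (a b : (Fin 0 → ℝ) → ℝ)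
    (h : Fin k → (Fin 0 → ℝ) → ℝ) (V V' : Fin k → (Fin 1 → ℝ) → ℝ),
    IsSemialgebraicFunOn ℚ r'.domain a →
    IsSemialgebraicFunOn ℚ r'.domain b →
    (∀ x ∈ r'.domain, a x ≤ b x) →
    r.domain = {z | (Fin.init z : Fin 0 → ℝ) ∈ r'.domain ∧ a (Fin.init z) ≤ z (Fin.last 0) ∧
      z (Fin.last 0) ≤ b (Fin.init z)} →
    (∀ i, IsSemialgebraicFunOn ℚ r'.domain (h i)) →
    (∀ i, IsSemialgebraicFunOn ℚ r.domain (V i)) →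
    (∀ i, ∀ z ∈ r.domain, 0 < V i z) →
    (∀ i, ∀ x ∈ r'.domain, ContinuousOn (fun t : ℝ => V i (Fin.snoc x t)) (Icc (a x) (b x))) →
    (∀ i, ∀ x ∈ r'.domain, ∀ t ∈ Ioo (a x) (b x),
      HasDerivAt (fun s : ℝ => V i (Fin.snoc x s)) (V' i (Fin.snoc x t)) t) →
    (∀ i, IntegrableOn (fun z => h i (Fin.init z) * V' i z / V i z) r.domain) →
    (∀ x ∈ r'.domain, ∀ t ∈ Ioo (a x) (b x),
      r.integrand (Fin.snoc x t) = ∑ i, h i x * V' i (Fin.snoc x t) / V i (Fin.snoc x t)) →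
    (∀ x ∈ r'.domain, r'.integrand x =
      ∑ i, h i x * (Real.log (V i (Fin.snoc x (b x))) - Real.log (V i (Fin.snoc x (a x))))) →
    KZ.of r - KZ.of r' ∈ KZ.relations

/-- `DimZero` is the case `n = 0` of the crux. -/
theorem dimZero_of_crux (hc : LogPrimitiveNL) : DimZero :=
  fun k r r' a b h V V' => hc 0 k r r' a b h V V'

/-- Boundary rigidity over the point (typed `n = 0` case of `BoundaryRigidity`;
content = Baker: `Σ βᵢ log αᵢ` algebraic ⇒ the relation is ℚ-multiplicative). MILESTONE, NOT A
HYPOTHESIS (D-0026): only the direction crux ⇒ `BoundaryRigidityDimZero` is recorded. -/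
def BoundaryRigidityDimZero : Prop :=
  ∀ (k : ℕ) (g : KZ.IntegralRep 0) (h W : Fin k → (Fin 0 → ℝ) → ℝ)
    (U : Fin k → KZ.IntegralRep 1),
    (∀ i, IsSemialgebraicFunOn ℚ g.domain (h i)) →
    (∀ i, IsSemialgebraicFunOn ℚ g.domain (W i)) →
    (∀ i, ∀ x ∈ g.domain, 1 ≤ W i x) →
    (∀ i, (U i).domain = {z | (Fin.init z : Fin 0 → ℝ) ∈ g.domain ∧ 1 ≤ z (Fin.last 0) ∧
      z (Fin.last 0) ≤ W i (Fin.init z)}) →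
    (∀ i, EqOn (U i).integrand (fun z => h i (Fin.init z) / z (Fin.last 0)) (U i).domain) →
    (∀ i, IntegrableOn (fun x => h i x * Real.log (W i x)) g.domain) →
    (∀ x ∈ g.domain, g.integrand x = ∑ i, h i x * Real.log (W i x)) →
    ∑ i, KZ.of (U i) - KZ.of g ∈ KZ.relations

/-- `BoundaryRigidityDimZero` is the case `n = 0` of `BoundaryRigidity`, hence also a consequence of
the crux. -/
theorem boundaryRigidityDimZero_of_crux (hc : LogPrimitiveNL) : BoundaryRigidityDimZero :=
  fun k g h W U => boundaryRigidity_of_crux hc 0 k g h W U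


/-! ## §9 Rigidity in the smallest case, formally: `n = 0`, `k = 1` instances are balanced

The first instance of §7.3(i) with the transcendence input available in the tree
(Hermite–Lindemann `transcendental_exp_holds`; algebraicity of the values of `ℚ`-semialgebraic
functions over the point — `isAlgebraic_of_isSemialgebraicFunOn_fin_zero`, after
`GammaHodgeSectorNegative.Algebraicity`). -/

section DimZeroRigidity

/-- **Hermite–Lindemann for real logarithms**: an algebraic `w > 0` with algebraic `log w` has
`log w = 0` (else `w = e^{log w}` would be transcendental, `transcendental_exp_holds`). -/
theorem log_eq_zero_of_isAlgebraic {w : ℝ} (hw : 0 < w) (halg : IsAlgebraic ℚ w)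
    (hlog : IsAlgebraic ℚ (Real.log w)) : Real.log w = 0 := by
  by_contra hne
  have hC : IsAlgebraic ℚ ((Real.log w : ℝ) : ℂ) := hlog.algebraMap
  have hne' : ((Real.log w : ℝ) : ℂ) ≠ 0 := by exact_mod_cast hne
  have ht := transcendental_exp_holds hC hne'
  apply ht
  rw [← Complex.ofReal_exp, Real.exp_log hw]
  exact halg.algebraMap

/-! ### Algebraicity over the point (copied from `GammaHodgeSectorNegative.Algebraicity` — another
route's negative kit — to avoid cross-route import coupling; same statements, same proofs) -/

open Literature.ModelTheory.ExponentialFields in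
/-- Evaluation of a polynomial in one variable `X₀` with rational coefficients factors through the
univariate polynomial obtained by `X₀ ↦ X`. [folklore] -/
theorem aeval_eq_aeval_uni (p : MvPolynomial (Fin 1) ℚ) (w : Fin 1 → ℝ) :
    MvPolynomial.aeval w p =
      Polynomial.aeval (w 0) (MvPolynomial.aeval (fun _ : Fin 1 => (Polynomial.X : Polynomial ℚ)) p) := by
  induction p using MvPolynomial.induction_on with
  | C a => simp
  | add p q hp hq => simp only [map_add, hp, hq]
  | mul_X p i hp =>
    have hi : i = 0 := Subsingleton.elim _ _
    subst hi
    simp only [map_mul, hp, MvPolynomial.aeval_X, Polynomial.aeval_X]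

open Literature.ModelTheory.ExponentialFields in
/-- **Dimension one, rational coefficients.** Every `ℚ`-semialgebraic subset of `ℝ¹` is, off the
zero set of some non-zero RATIONAL polynomial, both open and closed (induction over the Boolean
algebra). [folklore] -/
theorem exists_clopen_off_zeros {S : Set (Fin 1 → ℝ)} (hS : IsSemialgebraic ℚ S) :
    ∃ q : Polynomial ℚ, q ≠ 0 ∧ IsOpen (S ∩ {w | Polynomial.aeval (w 0) q ≠ 0}) ∧
      IsOpen (Sᶜ ∩ {w | Polynomial.aeval (w 0) q ≠ 0}) := by
  have hcont : ∀ q : Polynomial ℚ, Continuous fun w : Fin 1 → ℝ => Polynomial.aeval (w 0) q :=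
    fun q => (Polynomial.continuous_aeval q).comp (continuous_apply 0)
  unfold IsSemialgebraic semialgebraicSets at hS
  induction hS using BooleanSubalgebra.closure_bot_sup_induction with
  | mem S hS =>
    rcases hS with ⟨p, rfl⟩ | ⟨p, rfl⟩
    · set q := MvPolynomial.aeval (fun _ : Fin 1 => (Polynomial.X : Polynomial ℚ)) p with hq
      have hpq : ∀ w : Fin 1 → ℝ, MvPolynomial.aeval w p = Polynomial.aeval (w 0) q :=
        aeval_eq_aeval_uni p
      by_cases hq0 : q = 0
      · refine ⟨1, one_ne_zero, ?_, ?_⟩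
        · convert isOpen_univ
          ext w
          simp [hpq, hq0]
        · convert isOpen_empty
          ext w
          simp [hpq, hq0]
      · refine ⟨q, hq0, ?_, ?_⟩
        · convert isOpen_empty
          ext w
          simp only [mem_inter_iff, mem_setOf_eq, hpq, mem_empty_iff_false, iff_false, not_and,
            not_not]
          exact fun h => h
        · convert isOpen_ne_fun (hcont q) continuous_const using 1
          ext w
          simp only [mem_inter_iff, mem_compl_iff, mem_setOf_eq, hpq]
          tauto
    · set q := MvPolynomial.aeval (fun _ : Fin 1 => (Polynomial.X : Polynomial ℚ)) p with hq
      have hpq : ∀ w : Fin 1 → ℝ, MvPolynomial.aeval w p = Polynomial.aeval (w 0) q :=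
        aeval_eq_aeval_uni p
      by_cases hq0 : q = 0
      · refine ⟨1, one_ne_zero, ?_, ?_⟩
        · convert isOpen_empty
          ext w
          simp [hpq, hq0]
        · convert isOpen_univ
          ext w
          simp [hpq, hq0]
      · refine ⟨q, hq0, ?_, ?_⟩
        · convert isOpen_lt continuous_const (hcont q) using 1
          ext w
          simp only [mem_inter_iff, mem_setOf_eq, hpq]
          exact ⟨fun h => h.1, fun h => ⟨h, h.ne'⟩⟩
        · convert isOpen_lt (hcont q) continuous_const using 1
          ext w
          simp only [mem_inter_iff, mem_compl_iff, mem_setOf_eq, hpq, not_lt]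
          exact ⟨fun h => lt_of_le_of_ne h.1 h.2, fun h => ⟨h.le, h.ne⟩⟩
  | bot => exact ⟨1, one_ne_zero, by simp, by simp⟩
  | sup S _ T _ ihS ihT =>
    obtain ⟨p, hp, hp1, hp2⟩ := ihS
    obtain ⟨q, hq, hq1, hq2⟩ := ihT
    refine ⟨p * q, mul_ne_zero hp hq, ?_, ?_⟩
    · have : ((S ⊔ T) ∩ {w : Fin 1 → ℝ | Polynomial.aeval (w 0) (p * q) ≠ 0}) =
          (S ∩ {w | Polynomial.aeval (w 0) p ≠ 0}) ∩ {w | Polynomial.aeval (w 0) q ≠ 0} ∪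
            (T ∩ {w | Polynomial.aeval (w 0) q ≠ 0}) ∩ {w | Polynomial.aeval (w 0) p ≠ 0} := by
        ext w
        simp only [sup_eq_union, mem_inter_iff, mem_union, mem_setOf_eq, map_mul, mul_ne_zero_iff]
        tauto
      rw [this]
      exact (hp1.inter (isOpen_ne_fun (hcont q) continuous_const)).union
        (hq1.inter (isOpen_ne_fun (hcont p) continuous_const))
    · have : ((S ⊔ T)ᶜ ∩ {w : Fin 1 → ℝ | Polynomial.aeval (w 0) (p * q) ≠ 0}) =
          (Sᶜ ∩ {w | Polynomial.aeval (w 0) p ≠ 0}) ∩ (Tᶜ ∩ {w | Polynomial.aeval (w 0) q ≠ 0}) := by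
        ext w
        simp only [sup_eq_union, compl_union, mem_inter_iff, mem_compl_iff, mem_setOf_eq, map_mul,
          mul_ne_zero_iff]
        tauto
      rw [this]
      exact hp2.inter hq2
  | compl S _ ih =>
    obtain ⟨p, hp, h1, h2⟩ := ih
    exact ⟨p, hp, h2, by simpa only [compl_compl] using h1⟩

open Literature.ModelTheory.ExponentialFields in
/-- **A `ℚ`-semialgebraic point of `ℝ¹` is algebraic** (it is a root of the rational polynomial of
`exists_clopen_off_zeros`, else `{w₀}` would contain an interval). [folklore] -/
theorem isAlgebraic_of_isSemialgebraic_singleton {w₀ : Fin 1 → ℝ}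
    (h : IsSemialgebraic ℚ ({w₀} : Set (Fin 1 → ℝ))) : IsAlgebraic ℚ (w₀ 0) := by
  obtain ⟨q, hq0, hopen, -⟩ := exists_clopen_off_zeros h
  by_cases hroot : Polynomial.aeval (w₀ 0) q = 0
  · exact ⟨q, hq0, hroot⟩
  · exfalso
    have hmem : w₀ ∈ ({w₀} : Set (Fin 1 → ℝ)) ∩ {w | Polynomial.aeval (w 0) q ≠ 0} := ⟨rfl, hroot⟩
    obtain ⟨ε, hε, hball⟩ := Metric.isOpen_iff.mp hopen w₀ hmem
    have hmem' : (fun _ => w₀ 0 + ε / 2 : Fin 1 → ℝ) ∈ Metric.ball w₀ ε := by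
      rw [Metric.mem_ball, dist_pi_lt_iff hε]
      intro i
      rw [Subsingleton.elim i 0, Real.dist_eq, add_sub_cancel_left, abs_of_pos (half_pos hε)]
      exact half_lt_self hε
    have h0 := congr_fun (mem_singleton_iff.mp (hball hmem').1) 0
    simp only [add_eq_left] at h0
    exact absurd h0 (half_pos hε).ne'

/-- Over the point `ℝ⁰`, a `ℚ`-semialgebraic function has an algebraic value: its graph IS the
singleton `{(f x)} ⊂ ℝ¹`. -/
theorem isAlgebraic_of_isSemialgebraicFunOn_fin_zero {s : Set (Fin 0 → ℝ)} {f : (Fin 0 → ℝ) → ℝ}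
    (hf : IsSemialgebraicFunOn ℚ s f) {x : Fin 0 → ℝ} (hx : x ∈ s) : IsAlgebraic ℚ (f x) := by
  have hset : {z : Fin 1 → ℝ | ∃ y ∈ s, z = Fin.snoc y (f y)} = {Fin.snoc x (f x)} := by
    ext z
    simp only [mem_setOf_eq, mem_singleton_iff]
    constructor
    · rintro ⟨y, -, rfl⟩
      rw [Subsingleton.elim y x]
    · rintro rfl
      exact ⟨x, hx, rfl⟩
  have hsing : Literature.ModelTheory.ExponentialFields.IsSemialgebraic ℚ
      ({Fin.snoc x (f x)} : Set (Fin 1 → ℝ)) := by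
    have h' : Literature.ModelTheory.ExponentialFields.IsSemialgebraic ℚ
        {z : Fin 1 → ℝ | ∃ y ∈ s, z = Fin.snoc y (f y)} := hf
    rwa [hset] at h'
  have := isAlgebraic_of_isSemialgebraic_singleton hsing
  rwa [snoc_fin_one_apply_zero] at this

/-- Over the point, the endpoint value `y ↦ V (y, c y)` of a semialgebraic `V` on the band along a
semialgebraic edge `c` (with values in the band) is semialgebraic (composition, Tarski–Seidenberg:
`IsSemialgebraicFunOn.comp_isSemialgebraicMapOn_holds`). -/
theorem isSemialgebraicFunOn_endpoint {τ : Set (Fin 0 → ℝ)} {D : Set (Fin 1 → ℝ)}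
    (hτ : Literature.ModelTheory.ExponentialFields.IsSemialgebraic ℚ τ)
    {c : (Fin 0 → ℝ) → ℝ} (hc : IsSemialgebraicFunOn ℚ τ c) {V : (Fin 1 → ℝ) → ℝ}
    (hV : IsSemialgebraicFunOn ℚ D V) (hmaps : ∀ y ∈ τ, (Fin.snoc y (c y) : Fin 1 → ℝ) ∈ D) :
    IsSemialgebraicFunOn ℚ τ (fun y => V (Fin.snoc y (c y))) := by
  have hmap : IsSemialgebraicMapOn ℚ τ (fun y : Fin 0 → ℝ => (Fin.snoc y (c y) : Fin 1 → ℝ)) :=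
    IsSemialgebraicMapOn.of_forall hτ fun j => by
      have ej : j = Fin.last 0 := Fin.ext (by have := j.isLt; simp only [Fin.val_last]; omega)
      subst ej
      exact hc.congr fun y _ => by simp
  exact IsSemialgebraicFunOn.comp_isSemialgebraicMapOn_holds hV hmap fun y hy => hmaps y hy

/-- **Dimension `0`, one monomial: admissible instances are BALANCED.** In a datum of the crux with
`n = 0`, `k = 1` (only the hypotheses listed are used), over any base point either `h = 0` or
`V(·, b) = V(·, a)`: the boundary term `h·(log V(b) − log V(a))` is the value of the
`ℚ`-semialgebraic `r'.integrand`, hence algebraic, as are `h`, `V(a)`, `V(b)`; Hermite–Lindemann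
forbids a non-zero algebraic logarithm of the algebraic number `V(b)/V(a)`. So `[r'] = [pt, 0]`
for every admissible `k = 1` instance over the point — the smallest case of §7.3(i). -/
theorem dimZero_one_balanced (r : KZ.IntegralRep 1) (r' : KZ.IntegralRep 0)
    (a b : (Fin 0 → ℝ) → ℝ) (h : (Fin 0 → ℝ) → ℝ) (V : (Fin 1 → ℝ) → ℝ)
    (ha : IsSemialgebraicFunOn ℚ r'.domain a) (hb : IsSemialgebraicFunOn ℚ r'.domain b)
    (hab : ∀ x ∈ r'.domain, a x ≤ b x)
    (hdom : r.domain = {z | (Fin.init z : Fin 0 → ℝ) ∈ r'.domain ∧ a (Fin.init z) ≤ z (Fin.last 0) ∧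
      z (Fin.last 0) ≤ b (Fin.init z)})
    (hh : IsSemialgebraicFunOn ℚ r'.domain h) (hV : IsSemialgebraicFunOn ℚ r.domain V)
    (hpos : ∀ z ∈ r.domain, 0 < V z)
    (hr' : ∀ x ∈ r'.domain, r'.integrand x =
      h x * (Real.log (V (Fin.snoc x (b x))) - Real.log (V (Fin.snoc x (a x)))))
    {x : Fin 0 → ℝ} (hx : x ∈ r'.domain) :
    h x = 0 ∨ V (Fin.snoc x (b x)) = V (Fin.snoc x (a x)) := by
  have hBmem : ∀ y ∈ r'.domain, (Fin.snoc y (b y) : Fin 1 → ℝ) ∈ r.domain := fun y hy =>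
    (snoc_mem_band_iff hdom).2 ⟨hy, hab y hy, le_rfl⟩
  have hAmem : ∀ y ∈ r'.domain, (Fin.snoc y (a y) : Fin 1 → ℝ) ∈ r.domain := fun y hy =>
    (snoc_mem_band_iff hdom).2 ⟨hy, le_rfl, hab y hy⟩
  have algh : IsAlgebraic ℚ (h x) := isAlgebraic_of_isSemialgebraicFunOn_fin_zero hh hx
  have algr : IsAlgebraic ℚ (r'.integrand x) :=
    isAlgebraic_of_isSemialgebraicFunOn_fin_zero r'.isSemialgebraicFunOn_integrand hx
  have algB : IsAlgebraic ℚ (V (Fin.snoc x (b x))) :=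
    isAlgebraic_of_isSemialgebraicFunOn_fin_zero
      (isSemialgebraicFunOn_endpoint r'.isSemialgebraic_domain hb hV hBmem) hx
  have algA : IsAlgebraic ℚ (V (Fin.snoc x (a x))) :=
    isAlgebraic_of_isSemialgebraicFunOn_fin_zero
      (isSemialgebraicFunOn_endpoint r'.isSemialgebraic_domain ha hV hAmem) hx
  by_cases h0 : h x = 0
  · exact Or.inl h0
  right
  have hBpos : 0 < V (Fin.snoc x (b x)) := hpos _ (hBmem x hx)
  have hApos : 0 < V (Fin.snoc x (a x)) := hpos _ (hAmem x hx)
  have hquot : Real.log (V (Fin.snoc x (b x)) / V (Fin.snoc x (a x))) = r'.integrand x / h x := by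
    rw [Real.log_div hBpos.ne' hApos.ne', hr' x hx]
    field_simp
  have alglog : IsAlgebraic ℚ (Real.log (V (Fin.snoc x (b x)) / V (Fin.snoc x (a x)))) := by
    rw [hquot, div_eq_mul_inv]
    exact algr.mul algh.inv
  have hz := log_eq_zero_of_isAlgebraic (div_pos hBpos hApos)
    (by rw [div_eq_mul_inv]; exact algB.mul algA.inv) alglog
  have h1 := Real.eq_one_of_pos_of_log_eq_zero (div_pos hBpos hApos) hz
  rwa [div_eq_one_iff_eq hApos.ne'] at h1


/-! ### All `k` over the point: Baker -/

/-- **Baker, inhomogeneous corollary** (from `baker_holds`, Baker 1975 Thm. 2.1): an ALGEBRAIC value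
`β₀ = Σ βᵢ lᵢ` of a linear form with algebraic coefficients `βᵢ` in logarithms `lᵢ` of algebraic
numbers (`e^{lᵢ} ∈ ℚ̄`) is `0`. Proof: pass to a maximal `ℚ`-independent subfamily `b` of the `lᵢ`
(`exists_linearIndependent`); Baker makes `1, b` linearly independent over `ℚ̄`, so `1 ∉ span_ℚ̄ b`,
while `β₀ ∈ span_ℚ̄ (lᵢ) = span_ℚ̄ b`; if `β₀ ≠ 0` then `1 = β₀⁻¹ β₀ ∈ span_ℚ̄ b`. -/
theorem baker_sum_eq_zero {k : ℕ} (l β : Fin k → ℂ) (β₀ : ℂ)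
    (halg : ∀ i, IsAlgebraic ℚ (Complex.exp (l i))) (hβ : ∀ i, IsAlgebraic ℚ (β i))
    (hβ₀ : IsAlgebraic ℚ β₀) (hsum : ∑ i, β i * l i = β₀) : β₀ = 0 := by
  classical
  by_contra h0
  set K := algebraicClosure ℚ ℂ with hK
  obtain ⟨b, hb_sub, hb_span, hb_li⟩ := exists_linearIndependent ℚ (Set.range l)
  have halg' : ∀ x : b, IsAlgebraic ℚ (Complex.exp (x : ℂ)) := fun x => by
    obtain ⟨i, hi⟩ := hb_sub x.2
    rw [← hi]
    exact halg i
  have hB := baker_holds (fun x : b => (x : ℂ)) halg' hb_li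
  have hmem_range : β₀ ∈ Submodule.span K (Set.range l) := by
    rw [← hsum]
    refine Submodule.sum_mem _ fun i _ => ?_
    have hβi : β i ∈ K := mem_algebraicClosure_iff.mpr (hβ i)
    have : β i * l i = (⟨β i, hβi⟩ : K) • l i := by
      rw [IntermediateField.smul_def]
      rfl
    rw [this]
    exact Submodule.smul_mem _ _ (Submodule.subset_span ⟨i, rfl⟩)
  have hle : Submodule.span K (Set.range l) ≤ Submodule.span K (b : Set ℂ) := by
    rw [Submodule.span_le]
    intro x hx
    have hx' : x ∈ Submodule.span ℚ (b : Set ℂ) := by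
      rw [hb_span]
      exact Submodule.subset_span hx
    exact Submodule.span_le_restrictScalars ℚ K (b : Set ℂ) hx'
  have hmem : β₀ ∈ Submodule.span K (b : Set ℂ) := hle hmem_range
  have himage : (fun o : Option b => o.elim (1 : ℂ) (fun x : b => (x : ℂ))) '' Set.range some =
      (b : Set ℂ) := by
    ext y
    simp only [Set.mem_image, Set.mem_range, exists_exists_eq_and, Option.elim_some]
    exact ⟨fun ⟨x, hx⟩ => hx ▸ x.2, fun hy => ⟨⟨y, hy⟩, rfl⟩⟩
  have h1 : (1 : ℂ) ∉ Submodule.span K (b : Set ℂ) := by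
    have := hB.notMem_span_image (s := Set.range some) (x := none) (by simp)
    rwa [himage] at this
  have hβ₀K : β₀ ∈ K := mem_algebraicClosure_iff.mpr hβ₀
  have : (1 : ℂ) = (⟨β₀, hβ₀K⟩ : K)⁻¹ • β₀ := by
    rw [IntermediateField.smul_def]
    change (1 : ℂ) = ((⟨β₀, hβ₀K⟩ : K)⁻¹ : K) * β₀
    rw [show (((⟨β₀, hβ₀K⟩ : K)⁻¹ : K) : ℂ) = β₀⁻¹ from rfl, inv_mul_cancel₀ h0]
  exact h1 (this ▸ Submodule.smul_mem _ _ hmem)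

/-- **Over the point, EVERY admissible boundary representation is `[pt, 0]`** (all `k`; rigidity
§7.3(i) at `n = 0`, PROVED from Baker): in a datum of the crux with `n = 0` (only the hypotheses
listed are used), `r'.integrand x = 0` at the base point — `r'.integrand x = Σ hᵢ · log(Bᵢ/Aᵢ)` is an
algebraic value of a `ℚ̄`-linear form in logarithms of the algebraic numbers `Bᵢ/Aᵢ = Vᵢ(b)/Vᵢ(a)`
(`baker_sum_eq_zero`). Hence at `n = 0` the crux is exactly the derivability of `[r] ∈ KZ.relations`
for every admissible band datum (`dimZero_of_sub_mem`). -/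
theorem dimZero_boundary_eq_zero {k : ℕ} (r : KZ.IntegralRep 1) (r' : KZ.IntegralRep 0)
    (a b : (Fin 0 → ℝ) → ℝ) (h : Fin k → (Fin 0 → ℝ) → ℝ) (V : Fin k → (Fin 1 → ℝ) → ℝ)
    (ha : IsSemialgebraicFunOn ℚ r'.domain a) (hb : IsSemialgebraicFunOn ℚ r'.domain b)
    (hab : ∀ x ∈ r'.domain, a x ≤ b x)
    (hdom : r.domain = {z | (Fin.init z : Fin 0 → ℝ) ∈ r'.domain ∧ a (Fin.init z) ≤ z (Fin.last 0) ∧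
      z (Fin.last 0) ≤ b (Fin.init z)})
    (hh : ∀ i, IsSemialgebraicFunOn ℚ r'.domain (h i))
    (hV : ∀ i, IsSemialgebraicFunOn ℚ r.domain (V i))
    (hpos : ∀ i, ∀ z ∈ r.domain, 0 < V i z)
    (hr' : ∀ x ∈ r'.domain, r'.integrand x =
      ∑ i, h i x * (Real.log (V i (Fin.snoc x (b x))) - Real.log (V i (Fin.snoc x (a x)))))
    {x : Fin 0 → ℝ} (hx : x ∈ r'.domain) : r'.integrand x = 0 := by
  have hBmem : ∀ y ∈ r'.domain, (Fin.snoc y (b y) : Fin 1 → ℝ) ∈ r.domain := fun y hy =>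
    (snoc_mem_band_iff hdom).2 ⟨hy, hab y hy, le_rfl⟩
  have hAmem : ∀ y ∈ r'.domain, (Fin.snoc y (a y) : Fin 1 → ℝ) ∈ r.domain := fun y hy =>
    (snoc_mem_band_iff hdom).2 ⟨hy, le_rfl, hab y hy⟩
  set B : Fin k → ℝ := fun i => V i (Fin.snoc x (b x)) with hBdef
  set A : Fin k → ℝ := fun i => V i (Fin.snoc x (a x)) with hAdef
  have hBpos : ∀ i, 0 < B i := fun i => hpos i _ (hBmem x hx)
  have hApos : ∀ i, 0 < A i := fun i => hpos i _ (hAmem x hx)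
  have algh : ∀ i, IsAlgebraic ℚ (h i x) := fun i => isAlgebraic_of_isSemialgebraicFunOn_fin_zero (hh i) hx
  have algr : IsAlgebraic ℚ (r'.integrand x) :=
    isAlgebraic_of_isSemialgebraicFunOn_fin_zero r'.isSemialgebraicFunOn_integrand hx
  have algB : ∀ i, IsAlgebraic ℚ (B i) := fun i =>
    isAlgebraic_of_isSemialgebraicFunOn_fin_zero
      (isSemialgebraicFunOn_endpoint r'.isSemialgebraic_domain hb (hV i) hBmem) hx
  have algA : ∀ i, IsAlgebraic ℚ (A i) := fun i =>
    isAlgebraic_of_isSemialgebraicFunOn_fin_zero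
      (isSemialgebraicFunOn_endpoint r'.isSemialgebraic_domain ha (hV i) hAmem) hx
  -- complexify and apply Baker
  have hquot : ∀ i, Real.log (B i) - Real.log (A i) = Real.log (B i / A i) := fun i =>
    (Real.log_div (hBpos i).ne' (hApos i).ne').symm
  have hsumR : r'.integrand x = ∑ i, h i x * Real.log (B i / A i) := by
    rw [hr' x hx]
    exact Finset.sum_congr rfl fun i _ => by rw [← hquot i]
  have hsumC : ∑ i, ((h i x : ℝ) : ℂ) * ((Real.log (B i / A i) : ℝ) : ℂ) = ((r'.integrand x : ℝ) : ℂ) := by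
    rw [hsumR]
    push_cast
    rfl
  have halg : ∀ i, IsAlgebraic ℚ (Complex.exp ((Real.log (B i / A i) : ℝ) : ℂ)) := fun i => by
    rw [← Complex.ofReal_exp, Real.exp_log (div_pos (hBpos i) (hApos i)), div_eq_mul_inv]
    exact ((algB i).mul (algA i).inv).algebraMap
  have h0 := baker_sum_eq_zero (fun i => ((Real.log (B i / A i) : ℝ) : ℂ)) (fun i => ((h i x : ℝ) : ℂ))
    ((r'.integrand x : ℝ) : ℂ) halg (fun i => (algh i).algebraMap) algr.algebraMap hsumC
  exact_mod_cast h0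

/-- **At `n = 0` the base side is a relation**: for an admissible datum over the point,
`[r'] ∈ KZ.relations` (its integrand vanishes on its domain, `dimZero_boundary_eq_zero`), so the
crux's conclusion `[r] − [r'] ∈ relations` is equivalent to `[r] ∈ relations` there. -/
theorem dimZero_base_mem_relations {k : ℕ} (r : KZ.IntegralRep 1) (r' : KZ.IntegralRep 0)
    (a b : (Fin 0 → ℝ) → ℝ) (h : Fin k → (Fin 0 → ℝ) → ℝ) (V : Fin k → (Fin 1 → ℝ) → ℝ)
    (ha : IsSemialgebraicFunOn ℚ r'.domain a) (hb : IsSemialgebraicFunOn ℚ r'.domain b)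
    (hab : ∀ x ∈ r'.domain, a x ≤ b x)
    (hdom : r.domain = {z | (Fin.init z : Fin 0 → ℝ) ∈ r'.domain ∧ a (Fin.init z) ≤ z (Fin.last 0) ∧
      z (Fin.last 0) ≤ b (Fin.init z)})
    (hh : ∀ i, IsSemialgebraicFunOn ℚ r'.domain (h i))
    (hV : ∀ i, IsSemialgebraicFunOn ℚ r.domain (V i))
    (hpos : ∀ i, ∀ z ∈ r.domain, 0 < V i z)
    (hr' : ∀ x ∈ r'.domain, r'.integrand x =
      ∑ i, h i x * (Real.log (V i (Fin.snoc x (b x))) - Real.log (V i (Fin.snoc x (a x))))) :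
    KZ.of r' ∈ KZ.relations :=
  KZ.of_mem_relations_of_eqOn_zero r' fun _ hx =>
    dimZero_boundary_eq_zero r r' a b h V ha hb hab hdom hh hV hpos hr' hx

end DimZeroRigidity


/-! ## §10 The base side is ALWAYS a relation (all `n`): Baker pointwise + density

§9 over the point, now over any base: at every RATIONAL point of `τ` the boundary term is an
algebraic value of a `ℚ̄`-linear form in logarithms of algebraic numbers, hence `0` (Baker); an
admissible `r'.integrand` is semialgebraic, so smooth on an open `G ⊆ τ` of full measure
(`KZ.exists_isOpen_contDiffOn`), where it vanishes identically by density of `ℚⁿ`; so `[r'] ∈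
KZ.relations` (`base_mem_relations`). CONSEQUENCE (`crux_iff_bandForm`): **the crux is equivalent to
"every admissible BAND representation `[r]` is a relation"** — the base representation never
matters; together with §8 this localises all remaining content in the derivation of `[r]`
(equivalently `Σ [Uᵢ]`) from the four moves. -/

section BaseVanishing

/-- **Semialgebraic functions take algebraic values at rational points** (copied from
`GammaHodgeSectorNegative.Algebraicity` for the work file; the landed version imports it): slice the
graph at the rational point by a polynomial substitution and apply
`isAlgebraic_of_isSemialgebraic_singleton`. [folklore] -/
theorem isAlgebraic_apply_ratCast {m : ℕ} {s : Set (Fin m → ℝ)} {f : (Fin m → ℝ) → ℝ}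
    (hf : IsSemialgebraicFunOn ℚ s f) (z : Fin m → ℚ) (hz : (fun i => (z i : ℝ)) ∈ s) :
    IsAlgebraic ℚ (f fun i => (z i : ℝ)) := by
  rw [isSemialgebraicFunOn_iff] at hf
  set P : Fin (m + 1) → MvPolynomial (Fin 1) ℚ :=
    Fin.snoc (fun i => MvPolynomial.C (z i)) (MvPolynomial.X 0) with hPdef
  have hP : ∀ v : Fin 1 → ℝ,
      (fun j => MvPolynomial.aeval v (P j)) = Fin.snoc (fun i => (z i : ℝ)) (v 0) := by
    intro v
    ext j
    refine Fin.lastCases ?_ (fun i => ?_) j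
    · simp [hPdef]
    · simp [hPdef]
  have hT := hf.preimage_aeval P
  have hsing : Literature.ModelTheory.ExponentialFields.IsSemialgebraic ℚ
      ({fun _ : Fin 1 => f (fun i => (z i : ℝ))} : Set (Fin 1 → ℝ)) := by
    convert hT using 1
    ext v
    simp only [mem_singleton_iff, mem_preimage, mem_setOf_eq, hP v, Fin.init_snoc, Fin.snoc_last]
    constructor
    · rintro rfl
      exact ⟨hz, rfl⟩
    · rintro ⟨-, hv⟩
      funext i
      rw [Subsingleton.elim i 0]
      exact hv
  exact isAlgebraic_of_isSemialgebraic_singleton hsing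

/-- Over any base, the endpoint value `y ↦ V (y, c y)` of a semialgebraic `V` on the band along a
semialgebraic edge `c` (values in the band) is semialgebraic (composition, Tarski–Seidenberg). -/
theorem isSemialgebraicFunOn_endpointN {n : ℕ} {τ : Set (Fin n → ℝ)} {D : Set (Fin (n + 1) → ℝ)}
    (hτ : Literature.ModelTheory.ExponentialFields.IsSemialgebraic ℚ τ)
    {c : (Fin n → ℝ) → ℝ} (hc : IsSemialgebraicFunOn ℚ τ c) {V : (Fin (n + 1) → ℝ) → ℝ}
    (hV : IsSemialgebraicFunOn ℚ D V) (hmaps : ∀ y ∈ τ, (Fin.snoc y (c y) : Fin (n + 1) → ℝ) ∈ D) :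
    IsSemialgebraicFunOn ℚ τ (fun y => V (Fin.snoc y (c y))) := by
  have hmap : IsSemialgebraicMapOn ℚ τ
      (fun y : Fin n → ℝ => (Fin.snoc y (c y) : Fin (n + 1) → ℝ)) :=
    IsSemialgebraicMapOn.of_forall hτ fun j => by
      refine Fin.lastCases ?_ (fun i => ?_) j
      · simp only [Fin.snoc_last]
        exact hc
      · simp only [Fin.snoc_castSucc]
        exact isSemialgebraicFunOn_apply hτ i
  exact IsSemialgebraicFunOn.comp_isSemialgebraicMapOn_holds hV hmap fun y hy => hmaps y hy

/-- **Pointwise core (all `n`), function form**: a `ℚ`-semialgebraic function `g` of the shape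
`Σ hᵢ (log Bᵢ − log Aᵢ)` on `s` (`hᵢ`, `Aᵢ, Bᵢ > 0` `ℚ`-semialgebraic on `s`) VANISHES at every rational
point of `s`: the values `hᵢ(q), Aᵢ(q), Bᵢ(q), g(q)` are algebraic (`isAlgebraic_apply_ratCast`), and
Baker (`baker_sum_eq_zero`) kills an algebraic value of a `ℚ̄`-linear form in the logarithms of the
algebraic numbers `Bᵢ(q)/Aᵢ(q)`. -/
theorem logCombinationFun_eq_zero_ratCast {n k : ℕ} {s : Set (Fin n → ℝ)} (g : (Fin n → ℝ) → ℝ)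
    (h A B : Fin k → (Fin n → ℝ) → ℝ)
    (hh : ∀ i, IsSemialgebraicFunOn ℚ s (h i))
    (hA : ∀ i, IsSemialgebraicFunOn ℚ s (A i)) (hB : ∀ i, IsSemialgebraicFunOn ℚ s (B i))
    (hApos : ∀ i, ∀ x ∈ s, 0 < A i x) (hBpos : ∀ i, ∀ x ∈ s, 0 < B i x)
    (hgs : IsSemialgebraicFunOn ℚ s g)
    (hg : ∀ x ∈ s, g x = ∑ i, h i x * (Real.log (B i x) - Real.log (A i x)))
    (q : Fin n → ℚ) (hq : (fun i => (q i : ℝ)) ∈ s) :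
    g (fun i => (q i : ℝ)) = 0 := by
  set x : Fin n → ℝ := fun i => (q i : ℝ) with hxdef
  have hx : x ∈ s := hq
  have algh : ∀ i, IsAlgebraic ℚ (h i x) := fun i => isAlgebraic_apply_ratCast (hh i) q hq
  have algg : IsAlgebraic ℚ (g x) := isAlgebraic_apply_ratCast hgs q hq
  have algB : ∀ i, IsAlgebraic ℚ (B i x) := fun i => isAlgebraic_apply_ratCast (hB i) q hq
  have algA : ∀ i, IsAlgebraic ℚ (A i x) := fun i => isAlgebraic_apply_ratCast (hA i) q hq
  have hquot : ∀ i, Real.log (B i x) - Real.log (A i x) = Real.log (B i x / A i x) := fun i =>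
    (Real.log_div (hBpos i x hx).ne' (hApos i x hx).ne').symm
  have hsumR : g x = ∑ i, h i x * Real.log (B i x / A i x) := by
    rw [hg x hx]
    exact Finset.sum_congr rfl fun i _ => by rw [← hquot i]
  have hsumC : ∑ i, ((h i x : ℝ) : ℂ) * ((Real.log (B i x / A i x) : ℝ) : ℂ) = ((g x : ℝ) : ℂ) := by
    rw [hsumR]
    push_cast
    rfl
  have halg : ∀ i, IsAlgebraic ℚ (Complex.exp ((Real.log (B i x / A i x) : ℝ) : ℂ)) := fun i => by
    rw [← Complex.ofReal_exp, Real.exp_log (div_pos (hBpos i x hx) (hApos i x hx)), div_eq_mul_inv]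
    exact ((algB i).mul (algA i).inv).algebraMap
  have h0 := baker_sum_eq_zero (fun i => ((Real.log (B i x / A i x) : ℝ) : ℂ))
    (fun i => ((h i x : ℝ) : ℂ)) ((g x : ℝ) : ℂ) halg (fun i => (algh i).algebraMap)
    algg.algebraMap hsumC
  exact_mod_cast h0

/-- Representation form of `logCombinationFun_eq_zero_ratCast`. -/
theorem logCombination_eq_zero_ratCast {n k : ℕ} (g : KZ.IntegralRep n)
    (h A B : Fin k → (Fin n → ℝ) → ℝ)
    (hh : ∀ i, IsSemialgebraicFunOn ℚ g.domain (h i))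
    (hA : ∀ i, IsSemialgebraicFunOn ℚ g.domain (A i)) (hB : ∀ i, IsSemialgebraicFunOn ℚ g.domain (B i))
    (hApos : ∀ i, ∀ x ∈ g.domain, 0 < A i x) (hBpos : ∀ i, ∀ x ∈ g.domain, 0 < B i x)
    (hg : ∀ x ∈ g.domain, g.integrand x = ∑ i, h i x * (Real.log (B i x) - Real.log (A i x)))
    (q : Fin n → ℚ) (hq : (fun i => (q i : ℝ)) ∈ g.domain) :
    g.integrand (fun i => (q i : ℝ)) = 0 :=
  logCombinationFun_eq_zero_ratCast g.integrand h A B hh hA hB hApos hBpos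
    g.isSemialgebraicFunOn_integrand hg q hq

/-- Rational points are dense in `ℝⁿ`. -/
theorem dense_range_ratCast_pi (n : ℕ) :
    Dense (Set.range fun q : Fin n → ℚ => fun i => (q i : ℝ)) := by
  have hd : Dense (Set.pi Set.univ fun _ : Fin n => Set.range ((↑) : ℚ → ℝ)) :=
    dense_pi Set.univ fun _ _ => Rat.denseRange_cast
  refine hd.mono ?_
  intro y hy
  have hy' : ∀ i, y i ∈ Set.range ((↑) : ℚ → ℝ) := fun i => Set.mem_univ_pi.mp hy i
  choose q hq using hy'
  exact ⟨q, funext fun i => hq i⟩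

/-- **Vanishing on open sets, function form**: if moreover `g` is continuous on an OPEN `D ⊆ s`, then
`g ≡ 0` on `D` (rational points are dense; `logCombinationFun_eq_zero_ratCast`). In particular the
first conjunct `∀ x ∈ D, G x = 0` of the picked line's `stub_constRigidity` (constant algebraic
coefficients are constant `ℚ`-semialgebraic functions) and the `g ≡ 0 on cells` conjunct of
`stub_descent` hold wherever `g` is continuous on the (open) cell. -/
theorem logCombinationFun_eq_zero_on_open {n k : ℕ} {s D : Set (Fin n → ℝ)} (g : (Fin n → ℝ) → ℝ)
    (h A B : Fin k → (Fin n → ℝ) → ℝ)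
    (hh : ∀ i, IsSemialgebraicFunOn ℚ s (h i))
    (hA : ∀ i, IsSemialgebraicFunOn ℚ s (A i)) (hB : ∀ i, IsSemialgebraicFunOn ℚ s (B i))
    (hApos : ∀ i, ∀ x ∈ s, 0 < A i x) (hBpos : ∀ i, ∀ x ∈ s, 0 < B i x)
    (hgs : IsSemialgebraicFunOn ℚ s g)
    (hg : ∀ x ∈ s, g x = ∑ i, h i x * (Real.log (B i x) - Real.log (A i x)))
    (hDs : D ⊆ s) (hDo : IsOpen D) (hgc : ContinuousOn g D) : ∀ x ∈ D, g x = 0 := by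
  intro x hx
  by_contra hne
  have hUo : IsOpen (D ∩ g ⁻¹' ({(0 : ℝ)}ᶜ)) := hgc.isOpen_inter_preimage hDo isOpen_compl_singleton
  obtain ⟨y, ⟨q, rfl⟩, hyU⟩ := (dense_range_ratCast_pi n).exists_mem_open hUo ⟨x, hx, hne⟩
  exact hyU.2 (logCombinationFun_eq_zero_ratCast g h A B hh hA hB hApos hBpos hgs hg q (hDs hyU.1))

/-- **First conjunct of the picked line's `stub_constRigidity`, PROVED** (its hypotheses verbatim,
`ContinuousOn (W i) D` unused; algebraic constants are `ℚ`-semialgebraic functions,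
`isSemialgebraicFunOn_const_of_isAlgebraic`): an identity `Σ cᵢ log Wᵢ = G` on an open `ℚ`-semialgebraic `D` with
ALGEBRAIC constants `cᵢ`, positive `ℚ`-semialgebraic `Wᵢ` and continuous `ℚ`-semialgebraic `G` forces
`G ≡ 0` (Baker at rational points, density, continuity). -/
theorem constRigidity_vanishing :
    ∀ (n k : ℕ) (D : Set (Fin n → ℝ)) (c : Fin k → ℝ) (W : Fin k → (Fin n → ℝ) → ℝ)
      (G : (Fin n → ℝ) → ℝ), Literature.ModelTheory.ExponentialFields.IsSemialgebraic ℚ D → IsOpen D →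
      (∀ i, IsAlgebraic ℚ (c i)) →
      (∀ i, IsSemialgebraicFunOn ℚ D (W i)) → (∀ i, ContinuousOn (W i) D) →
      (∀ i, ∀ x ∈ D, 0 < W i x) → IsSemialgebraicFunOn ℚ D G → ContinuousOn G D →
      (∀ x ∈ D, ∑ i, c i * Real.log (W i x) = G x) →
      (∀ x ∈ D, G x = 0) := by
  intro n k D c W G hD hDo hc hW _ hWpos hG hGc hsum
  have hcsa : ∀ i, IsSemialgebraicFunOn ℚ D (fun _ => c i) := fun i =>
    isSemialgebraicFunOn_const_of_isAlgebraic hD (hc i)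
  have hone : IsSemialgebraicFunOn ℚ D (fun _ => (1 : ℝ)) := by
    simpa using isSemialgebraicFunOn_ratCast hD 1
  exact logCombinationFun_eq_zero_on_open G (fun i _ => c i) (fun _ _ => 1) W hcsa (fun _ => hone)
    hW (fun _ _ _ => one_pos) hWpos hG (fun x hx => by simp [← hsum x hx]) subset_rfl hDo hGc

/-- **Core (all `n`): a representation whose integrand has the shape `Σ hᵢ (log Bᵢ − log Aᵢ)` IS A
RELATION.** Its integrand vanishes at the rational points (`logCombination_eq_zero_ratCast`, Baker),
is `C^∞` on an open semialgebraic `G` of full measure in the domain (`KZ.exists_isOpen_contDiffOn`),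
hence vanishes on `G` (density of `ℚⁿ`, continuity); `[g] = [G, 0] + [dom ∖ G, ·]` (domain
additivity) is a zero integrand plus a null domain. -/
theorem logCombination_mem_relations {n k : ℕ} (g : KZ.IntegralRep n)
    (h A B : Fin k → (Fin n → ℝ) → ℝ)
    (hh : ∀ i, IsSemialgebraicFunOn ℚ g.domain (h i))
    (hA : ∀ i, IsSemialgebraicFunOn ℚ g.domain (A i)) (hB : ∀ i, IsSemialgebraicFunOn ℚ g.domain (B i))
    (hApos : ∀ i, ∀ x ∈ g.domain, 0 < A i x) (hBpos : ∀ i, ∀ x ∈ g.domain, 0 < B i x)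
    (hg : ∀ x ∈ g.domain, g.integrand x = ∑ i, h i x * (Real.log (B i x) - Real.log (A i x))) :
    KZ.of g ∈ KZ.relations := by
  obtain ⟨G, hGD, hGo, hG, hfG, hDG, hDG0⟩ :=
    KZ.exists_isOpen_contDiffOn g.isSemialgebraic_domain g.isSemialgebraicFunOn_integrand
  have hcont : ContinuousOn g.integrand G := hfG.continuousOn
  have hzero : ∀ x ∈ G, g.integrand x = 0 := by
    intro x hx
    by_contra hne
    have hUo : IsOpen (G ∩ g.integrand ⁻¹' ({(0 : ℝ)}ᶜ)) :=
      hcont.isOpen_inter_preimage hGo isOpen_compl_singleton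
    obtain ⟨y, ⟨q, rfl⟩, hyU⟩ := (dense_range_ratCast_pi n).exists_mem_open hUo ⟨x, hx, hne⟩
    exact hyU.2 (logCombination_eq_zero_ratCast g h A B hh hA hB hApos hBpos hg q (hGD hyU.1))
  have hNsub : g.domain \ G ⊆ g.domain := fun x hx => hx.1
  set rG := g.restrict G hG hGD with hrG
  set rN := g.restrict (g.domain \ G) hDG hNsub with hrN
  have hunion : g.domain = G ∪ (g.domain \ G) := by
    ext x
    constructor
    · intro hx
      by_cases hxG : x ∈ G
      · exact Or.inl hxG
      · exact Or.inr ⟨hx, hxG⟩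
    · rintro (hx | ⟨hx, -⟩)
      · exact hGD hx
      · exact hx
  have hinter : G ∩ (g.domain \ G) = ∅ := by
    ext x
    constructor
    · rintro ⟨h1, -, h2⟩
      exact (h2 h1).elim
    · intro hx
      exact hx.elim
  have hsplit : KZ.of g - KZ.of rG - KZ.of rN ∈ KZ.relations := by
    refine KZ.domainAddRel_subset_relations ⟨n, g, rG, rN, ?_, ?_, fun _ _ => rfl, fun _ _ => rfl, rfl⟩
    · simp only [hrG, hrN, KZ.IntegralRep.domain_restrict]
      exact hunion
    · simp only [hrG, hrN, KZ.IntegralRep.domain_restrict]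
      rw [hinter, measure_empty]
  have hG0 : KZ.of rG ∈ KZ.relations := KZ.of_mem_relations_of_eqOn_zero rG fun x hx => hzero x hx
  have hN0 : KZ.of rN ∈ KZ.relations := KZ.of_mem_relations_of_volume_eq_zero rN hDG0
  have e : KZ.of g = (KZ.of g - KZ.of rG - KZ.of rN) + KZ.of rG + KZ.of rN := by abel
  rw [e]
  exact add_mem (add_mem hsplit hG0) hN0

/-- **THE BASE SIDE OF THE CRUX IS ALWAYS A RELATION** (all `n`; only the listed hypotheses are used
— no `V'`, no band integrand): `[r'] ∈ KZ.relations` (`logCombination_mem_relations` with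
`Aᵢ = Vᵢ(·, a)`, `Bᵢ = Vᵢ(·, b)`, semialgebraic by `isSemialgebraicFunOn_endpointN`). -/
theorem base_mem_relations {n k : ℕ} (r : KZ.IntegralRep (n + 1)) (r' : KZ.IntegralRep n)
    (a b : (Fin n → ℝ) → ℝ) (h : Fin k → (Fin n → ℝ) → ℝ) (V : Fin k → (Fin (n + 1) → ℝ) → ℝ)
    (ha : IsSemialgebraicFunOn ℚ r'.domain a) (hb : IsSemialgebraicFunOn ℚ r'.domain b)
    (hab : ∀ x ∈ r'.domain, a x ≤ b x)
    (hdom : r.domain = {z | (Fin.init z : Fin n → ℝ) ∈ r'.domain ∧ a (Fin.init z) ≤ z (Fin.last n) ∧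
      z (Fin.last n) ≤ b (Fin.init z)})
    (hh : ∀ i, IsSemialgebraicFunOn ℚ r'.domain (h i))
    (hV : ∀ i, IsSemialgebraicFunOn ℚ r.domain (V i))
    (hpos : ∀ i, ∀ z ∈ r.domain, 0 < V i z)
    (hr' : ∀ x ∈ r'.domain, r'.integrand x =
      ∑ i, h i x * (Real.log (V i (Fin.snoc x (b x))) - Real.log (V i (Fin.snoc x (a x))))) :
    KZ.of r' ∈ KZ.relations := by
  have hBmem : ∀ y ∈ r'.domain, (Fin.snoc y (b y) : Fin (n + 1) → ℝ) ∈ r.domain := fun y hy =>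
    (snoc_mem_band_iff hdom).2 ⟨hy, hab y hy, le_rfl⟩
  have hAmem : ∀ y ∈ r'.domain, (Fin.snoc y (a y) : Fin (n + 1) → ℝ) ∈ r.domain := fun y hy =>
    (snoc_mem_band_iff hdom).2 ⟨hy, le_rfl, hab y hy⟩
  exact logCombination_mem_relations r' h (fun i y => V i (Fin.snoc y (a y)))
    (fun i y => V i (Fin.snoc y (b y))) hh
    (fun i => isSemialgebraicFunOn_endpointN r'.isSemialgebraic_domain ha (hV i) hAmem)
    (fun i => isSemialgebraicFunOn_endpointN r'.isSemialgebraic_domain hb (hV i) hBmem)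
    (fun i y hy => hpos i _ (hAmem y hy)) (fun i y hy => hpos i _ (hBmem y hy)) hr'

/-- **The base of `BoundaryRigidity` is always a relation** too: for `BoundaryRigidity` data,
`[g] ∈ KZ.relations` (`Aᵢ = 1`, `Bᵢ = Wᵢ`). -/
theorem br_base_mem_relations {n k : ℕ} (g : KZ.IntegralRep n) (h W : Fin k → (Fin n → ℝ) → ℝ)
    (hh : ∀ i, IsSemialgebraicFunOn ℚ g.domain (h i))
    (hW : ∀ i, IsSemialgebraicFunOn ℚ g.domain (W i)) (hW1 : ∀ i, ∀ x ∈ g.domain, 1 ≤ W i x)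
    (hg : ∀ x ∈ g.domain, g.integrand x = ∑ i, h i x * Real.log (W i x)) :
    KZ.of g ∈ KZ.relations :=
  logCombination_mem_relations g h (fun _ _ => 1) W hh
    (fun _ => by simpa using isSemialgebraicFunOn_ratCast g.isSemialgebraic_domain 1) hW
    (fun _ _ _ => one_pos) (fun i x hx => one_pos.trans_le (hW1 i x hx))
    fun x hx => by simp [hg x hx]

/-- **SUM FORM of `BoundaryRigidity`**: the unfolded monomial sum alone is a relation. REFORMULATION,
NOT A HYPOTHESIS (D-0026): equivalent to `BoundaryRigidity` (`boundaryRigidity_iff_sumForm`). -/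
def BoundarySumForm : Prop :=
  ∀ (n k : ℕ) (g : KZ.IntegralRep n) (h W : Fin k → (Fin n → ℝ) → ℝ)
    (U : Fin k → KZ.IntegralRep (n + 1)),
    (∀ i, IsSemialgebraicFunOn ℚ g.domain (h i)) →
    (∀ i, IsSemialgebraicFunOn ℚ g.domain (W i)) →
    (∀ i, ∀ x ∈ g.domain, 1 ≤ W i x) →
    (∀ i, (U i).domain = {z | (Fin.init z : Fin n → ℝ) ∈ g.domain ∧ 1 ≤ z (Fin.last n) ∧
      z (Fin.last n) ≤ W i (Fin.init z)}) →
    (∀ i, EqOn (U i).integrand (fun z => h i (Fin.init z) / z (Fin.last n)) (U i).domain) →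
    (∀ i, IntegrableOn (fun x => h i x * Real.log (W i x)) g.domain) →
    (∀ x ∈ g.domain, g.integrand x = ∑ i, h i x * Real.log (W i x)) →
    ∑ i, KZ.of (U i) ∈ KZ.relations

/-- `BoundaryRigidity ↔ BoundarySumForm`: the representation `g` never matters
(`br_base_mem_relations`); only the existence of SOME honest `g` with integrand `Σ hᵢ log Wᵢ`
(i.e. that this function is semialgebraic and integrable) remains as a hypothesis. -/
theorem boundaryRigidity_iff_sumForm : BoundaryRigidity ↔ BoundarySumForm := by
  constructor
  · intro hBR n k g h W U hh hW hW1 hUd hUi hUint hg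
    have h1 := hBR n k g h W U hh hW hW1 hUd hUi hUint hg
    have h2 := br_base_mem_relations g h W hh hW hW1 hg
    have e : ∑ i, KZ.of (U i) = (∑ i, KZ.of (U i) - KZ.of g) + KZ.of g := by abel
    rw [e]
    exact add_mem h1 h2
  · intro hS n k g h W U hh hW hW1 hUd hUi hUint hg
    exact sub_mem (hS n k g h W U hh hW hW1 hUd hUi hUint hg) (br_base_mem_relations g h W hh hW hW1 hg)

/-- **BAND FORM of the crux**: the same hypotheses, conclusion `[r] ∈ KZ.relations` (the base
representation dropped). MILESTONE/REFORMULATION, NOT A HYPOTHESIS (D-0026): it is EQUIVALENT to the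
crux (`crux_iff_bandForm`). -/
def BandForm : Prop :=
  ∀ (n k : ℕ) (r : KZ.IntegralRep (n + 1)) (r' : KZ.IntegralRep n) (a b : (Fin n → ℝ) → ℝ)
    (h : Fin k → (Fin n → ℝ) → ℝ) (V V' : Fin k → (Fin (n + 1) → ℝ) → ℝ),
    IsSemialgebraicFunOn ℚ r'.domain a →
    IsSemialgebraicFunOn ℚ r'.domain b →
    (∀ x ∈ r'.domain, a x ≤ b x) →
    r.domain = {z | (Fin.init z : Fin n → ℝ) ∈ r'.domain ∧ a (Fin.init z) ≤ z (Fin.last n) ∧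
      z (Fin.last n) ≤ b (Fin.init z)} →
    (∀ i, IsSemialgebraicFunOn ℚ r'.domain (h i)) →
    (∀ i, IsSemialgebraicFunOn ℚ r.domain (V i)) →
    (∀ i, ∀ z ∈ r.domain, 0 < V i z) →
    (∀ i, ∀ x ∈ r'.domain, ContinuousOn (fun t : ℝ => V i (Fin.snoc x t)) (Icc (a x) (b x))) →
    (∀ i, ∀ x ∈ r'.domain, ∀ t ∈ Ioo (a x) (b x),
      HasDerivAt (fun s : ℝ => V i (Fin.snoc x s)) (V' i (Fin.snoc x t)) t) →
    (∀ i, IntegrableOn (fun z => h i (Fin.init z) * V' i z / V i z) r.domain) →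
    (∀ x ∈ r'.domain, ∀ t ∈ Ioo (a x) (b x),
      r.integrand (Fin.snoc x t) = ∑ i, h i x * V' i (Fin.snoc x t) / V i (Fin.snoc x t)) →
    (∀ x ∈ r'.domain, r'.integrand x =
      ∑ i, h i x * (Real.log (V i (Fin.snoc x (b x))) - Real.log (V i (Fin.snoc x (a x))))) →
    KZ.of r ∈ KZ.relations

/-- **The crux is equivalent to its band form**: by `base_mem_relations` the base side `[r']` is a
relation for every admissible datum, so `[r] − [r'] ∈ relations ↔ [r] ∈ relations`. All content of
`LogPrimitiveNL` is the derivability of the BAND representation `[band, Σ hᵢVᵢ'/Vᵢ]` from the four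
moves (equivalently, via the tree engine, of `Σ [Uᵢ]`, §8). -/
theorem crux_iff_bandForm : LogPrimitiveNL ↔ BandForm := by
  constructor
  · intro hc n k r r' a b h V V' ha hb hab hdom hh hV hpos hcont hderiv hint hr hr'
    have h1 := hc n k r r' a b h V V' ha hb hab hdom hh hV hpos hcont hderiv hint hr hr'
    have h2 := base_mem_relations r r' a b h V ha hb hab hdom hh hV hpos hr'
    have e : KZ.of r = (KZ.of r - KZ.of r') + KZ.of r' := by abel
    rw [e]
    exact add_mem h1 h2
  · intro hB n k r r' a b h V V' ha hb hab hdom hh hV hpos hcont hderiv hint hr hr'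
    exact sub_mem (hB n k r r' a b h V V' ha hb hab hdom hh hV hpos hcont hderiv hint hr hr')
      (base_mem_relations r r' a b h V ha hb hab hdom hh hV hpos hr')


/-! ### The load-bearing hypothesis of the band form: admissibility of the base -/

/-- `BandForm` with the base-integrand hypothesis `hr'` DROPPED (the representation `r'` then only
carries the base `τ = r'.domain`): "every logarithmic band representation is a relation". -/
def BandFormWithoutBase : Prop :=
  ∀ (n k : ℕ) (r : KZ.IntegralRep (n + 1)) (r' : KZ.IntegralRep n) (a b : (Fin n → ℝ) → ℝ)
    (h : Fin k → (Fin n → ℝ) → ℝ) (V V' : Fin k → (Fin (n + 1) → ℝ) → ℝ),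
    IsSemialgebraicFunOn ℚ r'.domain a →
    IsSemialgebraicFunOn ℚ r'.domain b →
    (∀ x ∈ r'.domain, a x ≤ b x) →
    r.domain = {z | (Fin.init z : Fin n → ℝ) ∈ r'.domain ∧ a (Fin.init z) ≤ z (Fin.last n) ∧
      z (Fin.last n) ≤ b (Fin.init z)} →
    (∀ i, IsSemialgebraicFunOn ℚ r'.domain (h i)) →
    (∀ i, IsSemialgebraicFunOn ℚ r.domain (V i)) →
    (∀ i, ∀ z ∈ r.domain, 0 < V i z) →
    (∀ i, ∀ x ∈ r'.domain, ContinuousOn (fun t : ℝ => V i (Fin.snoc x t)) (Icc (a x) (b x))) →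
    (∀ i, ∀ x ∈ r'.domain, ∀ t ∈ Ioo (a x) (b x),
      HasDerivAt (fun s : ℝ => V i (Fin.snoc x s)) (V' i (Fin.snoc x t)) t) →
    (∀ i, IntegrableOn (fun z => h i (Fin.init z) * V' i z / V i z) r.domain) →
    (∀ x ∈ r'.domain, ∀ t ∈ Ioo (a x) (b x),
      r.integrand (Fin.snoc x t) = ∑ i, h i x * V' i (Fin.snoc x t) / V i (Fin.snoc x t)) →
    KZ.of r ∈ KZ.relations

/-- `repA = [[0,1], 1/(1+t)]` represents `log 2`. -/
theorem value_repA : repA.value = Real.log 2 := by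
  have hfc : ContinuousOn (fun t : ℝ => Real.log (1 + t)) (Icc 0 1) :=
    (continuousOn_const.add continuousOn_id).log fun t ht h0 => by
      simp only [Pi.add_apply, id_eq] at h0
      linarith [ht.1]
  have hfd : ∀ (x : Fin 0 → ℝ), ∀ t ∈ Ioo (0 : ℝ) 1,
      HasDerivAt (fun t : ℝ => Real.log (1 + t)) (1 / (1 + (Fin.snoc x t : Fin 1 → ℝ) 0)) t := by
    intro x t ht
    have h1 : (1 : ℝ) + t ≠ 0 := by have := ht.1; intro h0; linarith
    rw [snoc_fin_one_apply_zero]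
    exact (((hasDerivAt_id' t).const_add (1 : ℝ)).log h1).congr_deriv (by simp)
  have e : repA.value = ∫ z in band1 (0 : ℝ) 1, 1 / (1 + z 0) := rfl
  rw [e, setIntegral_band1_eq (G := fun z : Fin 1 → ℝ => 1 / (1 + z 0)) zero_le_one
    repA.integrableOn hfc hfd]
  norm_num

/-- **Admissibility of the base is THE load-bearing hypothesis of the band form**: drop `hr'` (the
existence of an honest base representation with integrand `Σ hᵢ(log Vᵢ(b) − log Vᵢ(a))`, i.e. the
semialgebraicity of the boundary function) and the statement is FALSE — witness `n = 0`, `k = 1`,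
`V = 1 + t`, `h = 1` on `[0, 1]`: `[r] = repA = [[0,1], 1/(1+t)]` has value `log 2 ≠ 0`, so it is no
relation (soundness). Compare §10: WITH `hr'` the base is automatically a relation; the whole force
of the crux's admissibility hypothesis is to make the band's value vanish. -/
theorem not_bandFormWithoutBase : ¬ BandFormWithoutBase := by
  intro H
  have hu := Literature.ModelTheory.ExponentialFields.isSemialgebraic_univ (k := ℚ) (R := ℝ)
    (ι := Fin 0)
  have hmem := H 0 1 repA (ptRep 0) (fun _ => 0) (fun _ => 1) (fun _ _ => 1)
    (fun _ z => 1 + z 0) (fun _ _ => 1)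
    ((isSemialgebraicFunOn_const hu 0).congr fun _ _ => by simp)
    ((isSemialgebraicFunOn_const hu 1).congr fun _ _ => by simp)
    (fun _ _ => zero_le_one) rfl
    (fun _ => (isSemialgebraicFunOn_const hu 1).congr fun _ _ => by simp)
    (fun _ => by
      show IsSemialgebraicFunOn ℚ (band1 0 1) (fun z : Fin 1 → ℝ => 1 + z 0)
      exact (isSemialgebraicFunOn_aeval isSemialgebraic_band1_zero_one
        (1 + MvPolynomial.X 0 : MvPolynomial (Fin 1) ℚ)).congr fun z _ => by simp)
    (fun _ z hz => by
      have h0 := (mem_band1.1 hz).1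
      show (0 : ℝ) < 1 + z 0
      linarith)
    (fun _ x _ => by
      show ContinuousOn (fun t : ℝ => 1 + (Fin.snoc x t : Fin 1 → ℝ) 0) (Icc 0 1)
      simp only [snoc_fin_one_apply_zero]
      exact continuousOn_const.add continuousOn_id)
    (fun _ x _ t _ => by
      show HasDerivAt (fun s : ℝ => 1 + (Fin.snoc x s : Fin 1 → ℝ) 0) 1 t
      simp only [snoc_fin_one_apply_zero]
      exact (hasDerivAt_id' t).const_add (1 : ℝ))
    (fun _ => by
      have hc' : ContinuousOn (fun z : Fin 1 → ℝ => (1 : ℝ) * 1 / (1 + z 0)) (band1 0 1) :=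
        continuousOn_const.div (continuousOn_const.add (continuous_apply 0).continuousOn)
          fun z hz => by have h := (mem_band1.1 hz).1; intro h0; linarith
      show IntegrableOn (fun z : Fin 1 → ℝ => (1 : ℝ) * 1 / (1 + z 0)) (band1 0 1)
      exact hc'.integrableOn_compact (isCompact_band1 0 1))
    (fun x _ t ht => by simp [repA])
  have hv : repA.value = 0 := by
    have := KZ.relations_le_ker_eval_holds hmem
    rwa [AddMonoidHom.mem_ker, KZ.eval_of] at this
  rw [value_repA] at hv
  linarith [Real.log_pos one_lt_two]

end BaseVanishing


/-! ## §12 Transcendence input for the line: Baker in relation-span form (from `baker_holds`)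

Landed as `Theorems/LogPrimitiveNL/Negative/BakerRelationSpan.lean` (p76753). -/

section RelationSpan

open Complex IntermediateField

/-- **Baker, relation-span form** (rational relation vectors): every `ℚ̄`-linear relation
`Σ cᵢ lᵢ = 0` among logarithms `lᵢ` of algebraic numbers is a `ℚ̄`-combination of ℚ-linear relations. -/
theorem baker_relation_span_rat :
    ∀ (k : ℕ) (l c : Fin k → ℂ), (∀ i, IsAlgebraic ℚ (cexp (l i))) → (∀ i, IsAlgebraic ℚ (c i)) →
      ∑ i, c i * l i = 0 →
      ∃ (R : ℕ) (m : Fin R → Fin k → ℚ) (β : Fin R → ℂ), (∀ r, IsAlgebraic ℚ (β r)) ∧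
        (∀ r, ∑ i, (m r i : ℂ) * l i = 0) ∧ ∀ i, c i = ∑ r, β r * (m r i : ℂ) := by
  intro k
  induction k with
  | zero =>
    intro l c _ _ _
    exact ⟨0, Fin.elim0, Fin.elim0, fun r => r.elim0, fun r => r.elim0, fun i => i.elim0⟩
  | succ k ih =>
    intro l c halg hc hrel
    classical
    by_cases hli : LinearIndependent ℚ l
    · -- Baker: all coefficients vanish
      have hB := baker_holds l halg hli
      set K := algebraicClosure ℚ ℂ
      have hzero : ∀ i, c i = 0 := by
        set g : Option (Fin (k + 1)) → K := fun o => o.elim 0 fun i => ⟨c i, mem_algebraicClosure_iff.mpr (hc i)⟩ with hg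
        have hsum : ∑ o, g o • (o.elim (1 : ℂ) l) = 0 := by
          rw [Fintype.sum_option]
          simp only [hg, Option.elim_none, Option.elim_some, zero_smul, zero_add]
          simpa [IntermediateField.smul_def] using hrel
        have h0 := Fintype.linearIndependent_iff.mp hB g hsum
        intro i
        have := h0 (some i)
        simpa [hg, Subtype.ext_iff] using this
      refine ⟨0, Fin.elim0, Fin.elim0, fun r => r.elim0, fun r => r.elim0, fun i => ?_⟩
      simp [hzero i]
    · -- a rational relation with a non-zero coefficient at `i₀`
      obtain ⟨a, ha, i₀, hi₀⟩ := Fintype.not_linearIndependent_iff.mp hli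
      have ha' : ∑ i, (a i : ℂ) * l i = 0 := by
        simpa [Rat.smul_def] using ha
      -- eliminate `l i₀`
      set l' : Fin k → ℂ := fun j => l (i₀.succAbove j) with hl'
      set c' : Fin k → ℂ := fun j => c (i₀.succAbove j) - c i₀ * ((a (i₀.succAbove j) : ℂ) / a i₀)
        with hc'
      have ha0 : (a i₀ : ℂ) ≠ 0 := by exact_mod_cast hi₀
      have hli₀ : l i₀ = -(∑ j, (a (i₀.succAbove j) : ℂ) * l' j) / a i₀ := by
        rw [Fin.sum_univ_succAbove _ i₀] at ha'
        rw [eq_div_iff ha0]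
        linear_combination ha'
      have hrel' : ∑ j, c' j * l' j = 0 := by
        rw [Fin.sum_univ_succAbove _ i₀, hli₀] at hrel
        have e : ∑ j, c' j * l' j =
            ∑ j, c (i₀.succAbove j) * l (i₀.succAbove j) -
              c i₀ / a i₀ * ∑ j, (a (i₀.succAbove j) : ℂ) * l' j := by
          simp only [hc', hl', sub_mul, Finset.sum_sub_distrib, Finset.mul_sum]
          congr 1
          exact Finset.sum_congr rfl fun j _ => by ring
        rw [e]
        have : c i₀ * (-(∑ j, (a (i₀.succAbove j) : ℂ) * l' j) / (a i₀ : ℂ)) =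
            -(c i₀ / a i₀ * ∑ j, (a (i₀.succAbove j) : ℂ) * l' j) := by ring
        rw [this] at hrel
        linear_combination hrel
      have halg' : ∀ j, IsAlgebraic ℚ (cexp (l' j)) := fun j => halg _
      have hc'alg : ∀ j, IsAlgebraic ℚ (c' j) := fun j =>
        (hc _).sub ((hc _).mul ((isAlgebraic_algebraMap (a (i₀.succAbove j))).mul
          (isAlgebraic_algebraMap (a i₀)).inv))
      obtain ⟨R', m', β', hβ', hm', hcm'⟩ := ih l' c' halg' hc'alg hrel'
      -- assemble: the old relations extended by `0` at `i₀`, plus `a` itself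
      refine ⟨R' + 1, Fin.snoc (fun r => Fin.insertNth i₀ 0 (m' r)) a,
        Fin.snoc β' (c i₀ / a i₀), ?_, ?_, ?_⟩
      · intro r
        refine Fin.lastCases ?_ (fun r' => ?_) r
        · simp only [Fin.snoc_last]
          rw [div_eq_mul_inv]
          exact (hc i₀).mul (isAlgebraic_algebraMap (a i₀)).inv
        · simpa using hβ' r'
      · intro r
        refine Fin.lastCases ?_ (fun r' => ?_) r
        · simpa using ha'
        · simp only [Fin.snoc_castSucc]
          rw [Fin.sum_univ_succAbove _ i₀, Fin.insertNth_apply_same]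
          simp only [Fin.insertNth_apply_succAbove, Rat.cast_zero, zero_mul, zero_add]
          exact hm' r'
      · intro i
        rw [Fin.sum_univ_castSucc]
        simp only [Fin.snoc_castSucc, Fin.snoc_last]
        rcases Fin.eq_self_or_eq_succAbove i₀ i with rfl | ⟨j, rfl⟩
        · simp only [Fin.insertNth_apply_same, Rat.cast_zero, mul_zero, Finset.sum_const_zero, zero_add]
          field_simp
        · simp only [Fin.insertNth_apply_succAbove]
          have := hcm' j
          simp only [hc'] at this
          rw [← this]
          field_simp
          ring

/-- Clearing denominators: a rational vector is an integer vector divided by a positive integer. -/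
theorem exists_nat_mul_eq_intCast {k : ℕ} (q : Fin k → ℚ) :
    ∃ (N : ℕ) (m : Fin k → ℤ), 0 < N ∧ ∀ i, (N : ℚ) * q i = m i := by
  classical
  refine ⟨∏ j, (q j).den, fun i => ((∏ j, (q j).den) / (q i).den : ℕ) * (q i).num, ?_, fun i => ?_⟩
  · exact Finset.prod_pos fun j _ => (q j).den_pos
  · have hdvd : (q i).den ∣ ∏ j, (q j).den := Finset.dvd_prod_of_mem _ (Finset.mem_univ i)
    have hden : ((q i).den : ℚ) ≠ 0 := by exact_mod_cast (q i).den_ne_zero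
    have e1 : ((∏ j, (q j).den : ℕ) : ℚ) = (((∏ j, (q j).den) / (q i).den : ℕ) : ℚ) * (q i).den := by
      rw [← Nat.cast_mul, Nat.div_mul_cancel hdvd]
    rw [e1, mul_assoc, mul_comm ((q i).den : ℚ) (q i), Rat.mul_den_eq_num]
    simp only [Int.cast_mul, Int.cast_natCast]

/-- **Baker, relation-span form, integer relations**: every `ℚ̄`-linear relation `Σ cᵢ lᵢ = 0` among
logarithms of algebraic numbers is a `ℚ̄`-combination of INTEGER relations `Σ mᵢ lᵢ = 0`, `m ∈ ℤᵏ`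
(so that `∏ (e^{lᵢ})^{mᵢ} = 1`). -/
theorem baker_relation_span_int {k : ℕ} (l c : Fin k → ℂ) (halg : ∀ i, IsAlgebraic ℚ (cexp (l i)))
    (hc : ∀ i, IsAlgebraic ℚ (c i)) (hrel : ∑ i, c i * l i = 0) :
    ∃ (R : ℕ) (m : Fin R → Fin k → ℤ) (β : Fin R → ℂ), (∀ r, IsAlgebraic ℚ (β r)) ∧
      (∀ r, ∑ i, (m r i : ℂ) * l i = 0) ∧ ∀ i, c i = ∑ r, β r * (m r i : ℂ) := by
  obtain ⟨R, mq, β, hβ, hmq, hcq⟩ := baker_relation_span_rat k l c halg hc hrel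
  choose N m hN hNm using fun r => exists_nat_mul_eq_intCast (mq r)
  refine ⟨R, m, fun r => β r / N r, fun r => ?_, fun r => ?_, fun i => ?_⟩
  · show IsAlgebraic ℚ (β r / (N r : ℂ))
    rw [div_eq_mul_inv]
    exact (hβ r).mul (isAlgebraic_nat (N r)).inv
  · have e : ∀ i, (m r i : ℂ) = (N r : ℂ) * (mq r i : ℂ) := fun i => by
      have := hNm r i
      have : ((m r i : ℚ) : ℂ) = (((N r : ℚ) * mq r i : ℚ) : ℂ) := by rw [this]
      push_cast at this
      exact this
    simp_rw [e, mul_assoc, ← Finset.mul_sum, hmq r, mul_zero]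
  · rw [hcq i]
    refine Finset.sum_congr rfl fun r _ => ?_
    have hN0 : (N r : ℂ) ≠ 0 := by exact_mod_cast (hN r).ne'
    have e : (m r i : ℂ) = (N r : ℂ) * (mq r i : ℂ) := by
      have := hNm r i
      have : ((m r i : ℚ) : ℂ) = (((N r : ℚ) * mq r i : ℚ) : ℂ) := by rw [this]
      push_cast at this
      exact this
    rw [e]
    field_simp


end RelationSpan

/-! ## §11 Targets: the picked line `logderiv-peeling` (stub inspection, cycle 1)

Skeleton `Cruxes/LogPrimitiveNL/Lines/logderiv-peeling.lean` (lead's 7-stub reshape of the planner's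
registered skeleton; glue `boundaryRigidity_of_stubs`, `LogPrimitiveNL_of` sorry-free). Inspection
(paper, each stub read against its hypotheses; no `stub-false` evidence filed):

* `stub_minNormalisation` (T1) — TRUE: `m x = min_{[a x, b x]} V(x,·)` exists (`V` continuous on the
  closed fibre), is positive and `ℚ`-semialgebraic (definable by Tarski–Seidenberg); integrability of
  `h log(V(·,ρ)/m)` from `|log(V(ρ)/V(t*))| ≤ ∫ₐᵇ |V'/V|` (FTC from the argmin) and Tonelli against
  `h V'/V ∈ L¹(band)`. (Degenerate fibres `a x = b x`: `m = V(x, a x)`, logs vanish.)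
* `stub_transfer` (T2) — TRUE in outline: `Ṽ = V/m ≥ 1` keeps `V'/V`; `BoundaryRigidity` is fed `2k`
  monomials `(h, Ṽ(·,b)), (−h, Ṽ(·,a))` whose coefficient sum reproduces `r'.integrand`; the tree
  engine needs the `ℚ`-semialgebraic `V'` (`hasDerivAt_last_isSemialgebraic_holds`) and the boundary
  integrability from T1. §4's four load-bearing hypotheses are all consumed here, as they must be.
* `stub_coneDecomposition` — TRUE (rational polyhedral cone `ker F ∩ ℝᵏ_{≥0}`, Carathéodory over its
  finitely many minimal-support integer generators; pad charts to a common width `p` with zero columns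
  and `b = 0`; take `m ≥ 1` so that `ℓ = 0` is covered).
* `stub_cellwiseFold` — TRUE in outline: chart pieces `{∏ W^{b_l} ≥ 1, Wᵢ^N = ∏_l (∏ W^{b_l})^{A_il}}`
  are semialgebraic; power rule + product rule (`KZ.of_sub_of_sub_mem_relations_mul`) with every
  intermediate monomial dominated by `N|hᵢ| log Wᵢ` (admissible); regrouped integrands
  `Σᵢ A_il hᵢ = Σ_r q_r (Σᵢ f_ri A_il) = 0`; integer division by `N`.
* `stub_peelingStep` — TRUE (everything differentiable on the open `U`; `log ∘ Wᵢ` differentiable as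
  `Wᵢ > 0`; semialgebraicity of partial derivatives = BPR Prop. 3.22).
* `stub_constRigidity` — TRUE, and its FIRST CONJUNCT IS PROVED HERE (`constRigidity_vanishing`, §10).
  Second conjunct (`c ∈ span_ℚ̄ {f ∈ ℤᵏ | ∏ Wᵢ^{fᵢ} ≡ 1 on D}`): Baker in RELATION-SPAN form at each
  rational point `q` (`c ∈ span_ℚ̄(Λ_q ⊗ ℚ)`, `Λ_q` = integer relations among the NUMBERS `Wᵢ(q)`),
  then `⋂_{q ∈ D ∩ ℚⁿ} Λ_q = Λ_D` by continuity of `x ↦ ∏ Wᵢ(x)^{fᵢ}` and density (finitely many `q`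
  suffice by the descending chain condition on subspaces of `ℚᵏ`), and base change `ℚ → ℚ̄` commutes
  with finite intersections of `ℚ`-subspaces. No Ax–Schanuel is needed — the docstring's plan is right.
  The relation-span form of Baker is now PROVED (§12: `baker_relation_span_rat`,
  `baker_relation_span_int`, by induction on `k` over `baker_holds`; LANDED as
  `Negative/BakerRelationSpan.lean`, p76753). Remaining for the stub: intersection of the relation
  lattices over the rational points of `D` and base change of finite intersections (linear algebra).
* `stub_descent` (hardest, lead) — TRUE by Ax–Schanuel (`ax_schanuel_holds`) + the above; the line's
  Ostrowski/Kolchin peeling induction is an elementary route to the same functional independence. Its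
  conclusion `g ≡ 0 on cells` is available from `logCombinationFun_eq_zero_on_open` as soon as `g` is
  continuous on the cell (cells are open and can be chosen inside the smooth locus of `g`), and is not
  even needed by the glue once `br_base_mem_relations` is imported (`[g] ∈ relations` is free).

RECOMMENDATION to the lead (also filed as evidence note): (i) import
`Theorems/LogPrimitiveNL/Negative/BandForm.lean` (landing) and delete the `hg0` branch of
`boundaryRigidity_of_stubs` (use `br_base_mem_relations`), then drop `(∀ x ∈ C c, g x = 0)` from
`stub_descent`'s conclusion — the hardest stub gets strictly weaker; (ii) take `constRigidity_vanishing`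
for the first conjunct of `stub_constRigidity`; (iii) take `baker_relation_span_int` (§12) as the
transcendence input of its second conjunct — what is left there is linear algebra over `ℚ`/`ℚ̄`.
-/

end Summit.KontsevichZagierPeriods.KontsevichZagierPeriods.Cruxes.LogPrimitiveNL.Disproof
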